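import Literature.RingTheory.MvPolynomial.KaltofenTestDefs
import Literature.RingTheory.MvPolynomial.KaltofenBoundsDegreeTools
import Literature.RingTheory.MvPolynomial.KaltofenBoundsNormTools
import Literature.RingTheory.MvPolynomial.KaltofenBoundsMatrixTools
import HarnessLib
import Mathlib.Algebra.Polynomial.Inductions

/-!
# Kaltofen's Theorem 4: degree and height of the Noether-form ingredients `Δ_S`

E. Kaltofen, *Effective Noether irreducibility forms and applications*, J. Comput. System Sci.
50 (1995) 274–295 [`Kaltofen1995`], §3 "Coefficient Growth Analysis" (Lemma 1, Thms. 1, 2, 4),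
carried out for the division-free objects of `KaltofenTestDefs` (namespace `KaltofenAIT`) on the
generic polynomial `genPoly d`. The two results used by the proof of Thm. 7 are

* `KaltofenBounds.totalDegree_genMinor_le : 2 ≤ d → (genMinor d S).totalDegree ≤ 12d⁶ − 2d⁵ − 10d⁴ + 4d³`,
* `KaltofenBounds.l1Norm_genMinor_le     : 2 ≤ d → l1Norm (genMinor d S) ≤ (2d)^(34d⁶)`,

i.e. exactly Kaltofen's `deg(Δ) ≤ 12 deg(f)⁶ − 2deg(f)⁵ − 10deg(f)⁴ + 4deg(f)³` and
`‖Δ‖ ≤ (2 deg f)^{34 deg(f)⁶}` of Thm. 4 / Thm. 7. The file is organised in five parts (each with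
its own header below): I the basic generic quantities (`f₀`, `ρ`, the cofactor `r`, the Taylor
data), II degrees along the scaled Newton iteration (Thms. 1, 2; entries of the matrix (29)),
III the degree of the minors (layer-cake count of the rows), IV norms along the Newton iteration
(majorant series with a small weight, for an arbitrary ring seminorm), V the height of the minors.
The bookkeeping devices are those of `KaltofenBoundsDegreeTools` (`wdeg`/`rdeg`/`sdeg`),
`KaltofenBoundsNormTools` (`rnorm`/`rSeminorm`) and `KaltofenBoundsMatrixTools`.

Definitions introduced here are explicit numerical constants (`rhoNn`, `cofNn`, `taylNn`, `cNn`,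
`gNn`, `ENn`) and the weighted seminorm `normRt`; no named facts.

## References

* E. Kaltofen, J. Comput. System Sci. 50 (1995) 274–295, §3 Lemma 1, Thms. 1–4, eq. (12)–(13),
  (27)–(29). [Kaltofen1995]
-/

/-!
# Part I — the basic generic quantities

Support file for the proof of Kaltofen's Theorem 7 (`kaltofen1995_thm7`; E. Kaltofen, *Effective
Noether irreducibility forms and applications*, J. Comput. System Sci. 50 (1995) 274–295, §3),
bounding the DEGREE in the generic coefficients `c` and the `1`-NORM of the basic quantities of
the absolute irreducibility test run on the generic polynomial `f = genPoly d` of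
`KaltofenTestDefs` (namespace `KaltofenAIT`):

* `f₀ = red (genPoly d) = z^d + Σ_{i<d} c_{i,0} zⁱ` (`red_genPoly_eq`): monic of degree `d`,
  `wdeg f₀ ≤ d` and `‖f₀ − z^d‖₂ ≤ 2^d` — the hypotheses of Kaltofen's Lemma 1 in the valuation
  form of `KaltofenBoundsDegreeTools` / `KaltofenBoundsNormTools`;
* the coefficients of `genPoly d` (degree `≤ 1`, norm `≤ 1`) and of `f₀'`;
* `ρ = rres (genPoly d) d` (Kaltofen's `ρ`, Thm. 1: `deg ρ ≤ 2d − 1`,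
  `‖ρ‖ ≤ (2d−1)! d^{2d−1}`);
* the cofactor `t = cofPoly (genPoly d) d` of `s f₀ + t f₀' = ρ` (coefficient degrees `≤ 2d − 2`,
  eq. (13)) and `r = cof (genPoly d) d ∈ R` (`rdeg ≤ 3d − 3`);
* the Taylor data `F_{j,i} = [yʲ] tayl (genPoly d) i` (`rdeg ≤ d`).

No new definitions, no named facts.

## References

* E. Kaltofen, J. Comput. System Sci. 50 (1995) 274–295, §3 (12)–(13), Lemma 1, Thm. 1.
  [Kaltofen1995]
-/

noncomputable section

open Polynomial

namespace Literature.RingTheory.MvPolynomial.KaltofenBounds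

open Literature.RingTheory.MvPolynomial.KaltofenAIT
open Literature.RingTheory.MvPolynomial.NoetherForms

/-! ### The coefficients of the generic polynomial -/

section GenPoly

variable (d : ℕ)

/-- The coefficient of `x^m yʲ` in `genPoly d`: `1` at `(d, 0)`, the variable `c_{m,j}` on the
generic support, `0` elsewhere. [folklore] -/
theorem coeff_coeff_genPoly (m j : ℕ) :
    ((genPoly d).coeff m).coeff j =
      (if m = d ∧ j = 0 then 1 else 0) + (if (m, j) ∈ genSupport d then MvPolynomial.X (m, j) else 0) := by
  classical
  rw [genPoly, coeff_add, coeff_X_pow, finsetSum_coeff, coeff_add]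
  congr 1
  · split_ifs with h1 h2 h2
    · rw [coeff_one, if_pos h2.2]
    · rw [coeff_one, if_neg]; intro hj; exact h2 ⟨h1, hj⟩
    · exact absurd h2.1 h1
    · rw [coeff_zero]
  · rw [finsetSum_coeff]
    have : ∀ p ∈ genSupport d, ((C (C (MvPolynomial.X p) * X ^ p.2) * X ^ p.1 :
        Polynomial (Polynomial GenCoeff)).coeff m).coeff j = if (m, j) = p then MvPolynomial.X p else 0 := by
      intro p _
      rw [coeff_C_mul_X_pow]
      split_ifs with h1 h2 h2
      · rw [coeff_C_mul_X_pow, if_pos]; rw [← h2]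
      · rw [coeff_C_mul_X_pow, if_neg]; intro hj; exact h2 (Prod.ext h1 hj)
      · exact absurd (congrArg Prod.fst h2) h1
      · rw [coeff_zero]
    rw [Finset.sum_congr rfl this, Finset.sum_ite_eq]

/-- The coefficients of `genPoly d` have total degree `≤ 1`. [folklore] -/
theorem totalDegree_coeff_coeff_genPoly_le (m j : ℕ) : (((genPoly d).coeff m).coeff j).totalDegree ≤ 1 := by
  rw [coeff_coeff_genPoly]
  refine (MvPolynomial.totalDegree_add _ _).trans (max_le ?_ ?_)
  · split_ifs
    · rw [MvPolynomial.totalDegree_one]; exact Nat.zero_le _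
    · rw [MvPolynomial.totalDegree_zero]; exact Nat.zero_le _
  · split_ifs
    · exact (MvPolynomial.totalDegree_X (R := ℤ) _).le
    · rw [MvPolynomial.totalDegree_zero]; exact Nat.zero_le _

/-- Sharper: the coefficient of `x^m yʲ` (`m ≤ d`) has total degree `≤ d − m`
(the leading coefficient is the constant `1`). [folklore] -/
theorem totalDegree_coeff_coeff_genPoly_add_le (m j : ℕ) (hm : m ≤ d) :
    (((genPoly d).coeff m).coeff j).totalDegree + m ≤ d := by
  rcases Nat.lt_or_ge m d with h | h
  · have := totalDegree_coeff_coeff_genPoly_le d m j; omega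
  · have hmd : m = d := le_antisymm hm h
    rw [coeff_coeff_genPoly, if_neg (fun hmem => absurd (mem_genSupport.1 hmem).1 (by omega)), add_zero]
    split_ifs
    · rw [MvPolynomial.totalDegree_one]; omega
    · rw [MvPolynomial.totalDegree_zero]; omega

/-- The coefficients of `genPoly d` have `1`-norm `≤ 1`. [folklore] -/
theorem l1Norm_coeff_coeff_genPoly_le (m j : ℕ) : l1Norm (((genPoly d).coeff m).coeff j) ≤ 1 := by
  rw [coeff_coeff_genPoly]
  by_cases h : m = d ∧ j = 0
  · rw [if_pos h, if_neg, add_zero, l1Norm_one]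
    intro hmem; exact absurd (mem_genSupport.1 hmem).1 (by omega)
  · rw [if_neg h, zero_add]
    split_ifs
    · rw [l1Norm_X]
    · rw [l1Norm_zero]; exact Nat.zero_le _

/-- `genPoly d` has `x`-degree `d`. [folklore] -/
theorem natDegree_genPoly : (genPoly d).natDegree = d := (genPoly_natDegree_and_monic d).1

/-- Coefficients of `genPoly d` beyond `x^d` vanish. [folklore] -/
theorem coeff_genPoly_eq_zero {m : ℕ} (hm : d < m) : (genPoly d).coeff m = 0 :=
  coeff_eq_zero_of_natDegree_lt (by rwa [natDegree_genPoly])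

end GenPoly

/-! ### `f₀ = P(z, 0)` of the generic polynomial -/

section F0

variable (d : ℕ)

/-- `f₀ = z^d + Σ_{i<d} c_{i,0} zⁱ`. [cite: Kaltofen1995, §3 (before Lemma 1)] -/
theorem red_genPoly_eq :
    red (genPoly d) = X ^ d + ∑ i ∈ Finset.range d, C (MvPolynomial.X (i, 0)) * X ^ i := by
  classical
  rw [red, genPoly, Polynomial.map_add, Polynomial.map_pow, map_X, Polynomial.map_sum]
  congr 1
  simp only [Polynomial.map_mul, Polynomial.map_pow, map_X, map_C, coe_evalRingHom, eval_mul, eval_C,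
    eval_pow, eval_X]
  rw [← Finset.sum_filter_add_sum_filter_not (genSupport d) (fun p => p.2 = 0)]
  have hzero : ∑ p ∈ (genSupport d).filter (fun p => ¬p.2 = 0),
      (C (MvPolynomial.X p * 0 ^ p.2) * X ^ p.1 : Polynomial GenCoeff) = 0 := by
    refine Finset.sum_eq_zero fun p hp => ?_
    rw [Finset.mem_filter] at hp
    rw [zero_pow hp.2, mul_zero, map_zero, zero_mul]
  have hfilter : (genSupport d).filter (fun p => p.2 = 0) = (Finset.range d).image fun i => (i, 0) := by
    ext ⟨a, b⟩
    simp only [Finset.mem_filter, mem_genSupport, Finset.mem_image, Finset.mem_range, Prod.mk.injEq]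
    constructor
    · rintro ⟨⟨h1, -⟩, rfl⟩; exact ⟨a, h1, rfl, rfl⟩
    · rintro ⟨i, hi, rfl, rfl⟩; exact ⟨⟨hi, by omega⟩, rfl⟩
  rw [hzero, add_zero, hfilter, Finset.sum_image (fun i _ j _ h => (Prod.mk.inj h).1)]
  refine Finset.sum_congr rfl fun i _ => ?_
  rw [pow_zero, mul_one]

/-- The tail of `f₀` has `z`-degree `< d`. [folklore] -/
theorem degree_red_genPoly_tail_lt :
    (∑ i ∈ Finset.range d, C (MvPolynomial.X (i, 0)) * X ^ i : Polynomial GenCoeff).degree < d := by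
  refine (degree_sum_le _ _).trans_lt ((Finset.sup_lt_iff (WithBot.bot_lt_coe d)).2 fun i hi => ?_)
  refine (degree_C_mul_X_pow_le _ _).trans_lt ?_
  exact WithBot.coe_lt_coe.2 (Finset.mem_range.1 hi)

/-- `f₀` is monic of degree `d`. [folklore] -/
theorem natDegree_red_genPoly : (red (genPoly d)).natDegree = d := by
  nontriviality GenCoeff
  rw [red_genPoly_eq, natDegree_add_eq_left_of_degree_lt, natDegree_X_pow]
  rw [degree_X_pow]; exact degree_red_genPoly_tail_lt d

/-- `wdeg f₀ ≤ d`: the hypothesis of Kaltofen's Lemma 1 (degrees). [cite: Kaltofen1995, §3 Lemma 1] -/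
theorem wdeg_red_genPoly_le : wdeg (red (genPoly d)) ≤ (red (genPoly d)).natDegree := by
  rw [natDegree_red_genPoly, red_genPoly_eq]
  refine (wdeg_add_le _ _).trans (max_le (wdeg_X_pow_le d) ?_)
  refine (wdeg_sum_le _ _).trans (Finset.sup_le fun i hi => ?_)
  refine (wdeg_C_mul_X_pow_le _ _).trans ?_
  have := MvPolynomial.totalDegree_X (R := ℤ) ((i, 0) : ℕ × ℕ)
  have hi' := Finset.mem_range.1 hi
  omega

/-- `‖f₀ − z^d‖₂ ≤ 2^d` (indeed `= 2^d − 1`): the hypothesis of Kaltofen's Lemma 1 (norms).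
[cite: Kaltofen1995, §3 Lemma 1] -/
theorem polyNorm_red_genPoly_tail_le :
    polyNorm (l1Seminorm (ℕ × ℕ)) 2 (red (genPoly d) - X ^ (red (genPoly d)).natDegree) ≤
      (2 : ℝ) ^ (red (genPoly d)).natDegree := by
  rw [natDegree_red_genPoly, red_genPoly_eq, add_sub_cancel_left]
  refine (polyNorm_sum_le _ (by norm_num) _ _).trans ?_
  have hterm : ∀ i ∈ Finset.range d, polyNorm (l1Seminorm (ℕ × ℕ)) 2
      (C (MvPolynomial.X (i, 0)) * X ^ i : Polynomial GenCoeff) = (2 : ℝ) ^ i := by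
    intro i _
    rw [C_mul_X_pow_eq_monomial, polyNorm_monomial, l1Seminorm_apply, l1Norm_X, Nat.cast_one, one_mul]
  rw [Finset.sum_congr rfl hterm, geom_sum_eq (by norm_num) d]
  norm_num

/-- The coefficients of `f₀` have total degree `≤ 1`. [folklore] -/
theorem totalDegree_coeff_red_genPoly_le (k : ℕ) : ((red (genPoly d)).coeff k).totalDegree ≤ 1 := by
  rw [red, coeff_map, coe_evalRingHom, ← coeff_zero_eq_eval_zero]
  exact totalDegree_coeff_coeff_genPoly_le d k 0

/-- The coefficients of `f₀` have `1`-norm `≤ 1`. [folklore] -/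
theorem l1Norm_coeff_red_genPoly_le (k : ℕ) : l1Norm ((red (genPoly d)).coeff k) ≤ 1 := by
  rw [red, coeff_map, coe_evalRingHom, ← coeff_zero_eq_eval_zero]
  exact l1Norm_coeff_coeff_genPoly_le d k 0

/-- The coefficients of `f₀'` have total degree `≤ 1`. [folklore] -/
theorem totalDegree_coeff_derivative_red_genPoly_le (k : ℕ) :
    ((derivative (red (genPoly d))).coeff k).totalDegree ≤ 1 := by
  rw [coeff_derivative, ← Nat.cast_succ, ← nsmul_eq_mul']
  exact (MvPolynomial.totalDegree_smul_le _ _).trans (totalDegree_coeff_red_genPoly_le d _)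

/-- The coefficients of `f₀'` have `1`-norm `≤ d`. [folklore] -/
theorem l1Norm_coeff_derivative_red_genPoly_le (k : ℕ) :
    l1Norm ((derivative (red (genPoly d))).coeff k) ≤ d := by
  rw [coeff_derivative]
  by_cases hk : k + 1 ≤ d
  · refine (l1Norm_mul_le _ _).trans ?_
    have h1 := l1Norm_coeff_red_genPoly_le d (k + 1)
    have h2 : l1Norm ((↑k + 1 : GenCoeff)) = k + 1 := by
      rw [← Nat.cast_succ, ← map_natCast (MvPolynomial.C : ℤ →+* GenCoeff), l1Norm_C]; rfl
    rw [h2]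
    calc l1Norm ((red (genPoly d)).coeff (k + 1)) * (k + 1) ≤ 1 * (k + 1) := Nat.mul_le_mul_right _ h1
      _ = k + 1 := one_mul _
      _ ≤ d := hk
  · rw [coeff_eq_zero_of_natDegree_lt (by rw [natDegree_red_genPoly]; omega), zero_mul, l1Norm_zero]
    exact Nat.zero_le _

end F0

/-! ### `ρ` and the cofactor -/

section Rho

variable (d : ℕ)

/-- **Kaltofen's Thm. 1 (degree of `ρ`):** `deg ρ ≤ 2d − 1` (`= d + (d − 1)` rows of Sylvester entries
of degree `≤ 1`). [cite: Kaltofen1995, §3 Thm. 1 (13)] -/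
theorem totalDegree_rres_le : (rres (genPoly d) d).totalDegree ≤ d + (d - 1) := by
  rw [rres, resultant]
  refine (totalDegree_det_le_sum_rows _ (fun _ => 1) ?_).trans ?_
  · exact forall_sylvester' (fun x : GenCoeff => x.totalDegree ≤ 1)
      (by rw [MvPolynomial.totalDegree_zero]; exact Nat.zero_le _) _ _ _ _
      (totalDegree_coeff_red_genPoly_le d) (totalDegree_coeff_derivative_red_genPoly_le d)
  · rw [Finset.sum_const, Finset.card_univ, Fintype.card_fin, smul_eq_mul, mul_one]

/-- **Kaltofen's Thm. 1 (norm of `ρ`):** `‖ρ‖ ≤ (2d−1)! · d^{2d−1}`. [cite: Kaltofen1995, §3 Thm. 1 (13)] -/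
theorem l1Norm_rres_le (hd : d ≠ 0) :
    (l1Norm (rres (genPoly d) d) : ℝ) ≤ (d + (d - 1)).factorial * (d : ℝ) ^ (d + (d - 1)) := by
  rw [rres, resultant, ← l1Seminorm_apply]
  have h := seminorm_det_le (l1Seminorm (ℕ × ℕ)) (by rw [l1Seminorm_one]) (sylvester (red (genPoly d))
    (derivative (red (genPoly d))) d (d - 1)) (fun _ => (d : ℝ)) (fun _ => Nat.cast_nonneg d) ?_
  · rwa [Finset.prod_const, Finset.card_univ, Fintype.card_fin] at h
  · refine forall_sylvester' (fun x => l1Seminorm (ℕ × ℕ) x ≤ (d : ℝ)) (by rw [map_zero]; exact Nat.cast_nonneg d)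
      _ _ _ _ (fun i => ?_) (fun i => ?_)
    · rw [l1Seminorm_apply]
      exact_mod_cast (l1Norm_coeff_red_genPoly_le d i).trans (Nat.one_le_iff_ne_zero.2 hd)
    · rw [l1Seminorm_apply]; exact_mod_cast l1Norm_coeff_derivative_red_genPoly_le d i

/-- The coefficients of Kaltofen's cofactor `t(z) = cofPoly` have total degree `≤ 2d − 2`.
[cite: Kaltofen1995, §3 (13)] -/
theorem totalDegree_coeff_cofPoly_le (hd : d ≠ 0) (j : ℕ) :
    ((cofPoly (genPoly d) d).coeff j).totalDegree ≤ d + (d - 1) - 1 := by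
  rw [cofPoly, dif_neg hd]
  have h := totalDegree_coeff_adjSylvester_fst_one_le (red (genPoly d)) (derivative (red (genPoly d)))
    (m := d) (n := d - 1) (one_mem_degreeLT hd) (by omega) 1
    (totalDegree_coeff_red_genPoly_le d) (totalDegree_coeff_derivative_red_genPoly_le d) j
  rwa [mul_one] at h

/-- The coefficients of `cofPoly` have `1`-norm `≤ (2d−1)! · d^{2d−2}`. [cite: Kaltofen1995, §3 (13), Thm. 3] -/
theorem l1Norm_coeff_cofPoly_le (hd : d ≠ 0) (j : ℕ) :
    (l1Norm ((cofPoly (genPoly d) d).coeff j) : ℝ) ≤ (d + (d - 1)).factorial * (d : ℝ) ^ (d + (d - 1) - 1) := by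
  rw [cofPoly, dif_neg hd, ← l1Seminorm_apply]
  refine seminorm_coeff_adjSylvester_fst_one_le (l1Seminorm (ℕ × ℕ)) (by rw [l1Seminorm_one])
    (red (genPoly d)) (derivative (red (genPoly d))) (m := d) (n := d - 1) (one_mem_degreeLT hd)
    (by omega) (d : ℝ) (Nat.cast_nonneg d) (fun i => ?_) (fun i => ?_) j
  · rw [l1Seminorm_apply]
    exact_mod_cast (l1Norm_coeff_red_genPoly_le d i).trans (Nat.one_le_iff_ne_zero.2 hd)
  · rw [l1Seminorm_apply]; exact_mod_cast l1Norm_coeff_derivative_red_genPoly_le d i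

/-- `cofPoly` has `z`-degree `< d`. [folklore] -/
theorem natDegree_cofPoly_lt (hd : d ≠ 0) : (cofPoly (genPoly d) d).natDegree < d ∨ cofPoly (genPoly d) d = 0 := by
  by_cases h0 : cofPoly (genPoly d) d = 0
  · exact Or.inr h0
  · left
    have hmem := (adjSylvester (m := d) (n := d - 1) (red (genPoly d)) (derivative (red (genPoly d)))
      ⟨1, one_mem_degreeLT hd⟩).1.2
    rw [mem_degreeLT] at hmem
    have : (cofPoly (genPoly d) d).degree < d := by rwa [cofPoly, dif_neg hd]
    rw [degree_eq_natDegree h0] at this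
    exact_mod_cast this

/-- `wdeg` of a polynomial of `z`-degree `< D` with coefficient degrees `≤ B` is `≤ B + (D − 1)`.
[folklore] -/
theorem wdeg_le_of_coeff_le {σ : Type*} {A : Type*} [CommRing A] (P : Polynomial (MvPolynomial σ A))
    (B D : ℕ) (hD : P.natDegree < D) (h : ∀ j, (P.coeff j).totalDegree ≤ B) : wdeg P ≤ B + (D - 1) := by
  conv_lhs => rw [P.as_sum_range' D hD]
  refine (wdeg_sum_le _ _).trans (Finset.sup_le fun j hj => ?_)
  rw [← C_mul_X_pow_eq_monomial]
  refine (wdeg_C_mul_X_pow_le _ _).trans ?_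
  have := h j
  have hj' := Finset.mem_range.1 hj
  omega

/-- `rdeg r ≤ 3d − 3` for Kaltofen's `r = cof` (`= t(z̄)`): coefficient degrees `≤ 2d − 2`,
`z`-degree `≤ d − 1`. [cite: Kaltofen1995, §3 (13)] -/
theorem rdeg_cof_le (hd : d ≠ 0) :
    rdeg (red_genPoly_monic d) (cof (genPoly d) d) ≤ (d + (d - 1) - 1) + (d - 1) := by
  rw [cof]
  refine (rdeg_mk_le _ (wdeg_red_genPoly_le d) _).trans ?_
  rcases natDegree_cofPoly_lt d hd with h | h
  · exact wdeg_le_of_coeff_le _ _ d h (totalDegree_coeff_cofPoly_le d hd)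
  · rw [h, wdeg_zero]; exact Nat.zero_le _

/-- `polyNorm` of a polynomial of `z`-degree `< D` with coefficient norms `≤ B` (`B ≥ 0`, `t ≥ 1`)
is `≤ D · B · t^{D−1}`. [folklore] -/
theorem polyNorm_le_of_coeff_le {R : Type*} [CommRing R] (p : RingSeminorm R) {t : ℝ} (ht : 1 ≤ t)
    (P : R[X]) (B : ℝ) (hB : 0 ≤ B) (D : ℕ) (hD : P.natDegree < D) (h : ∀ j, p (P.coeff j) ≤ B) :
    polyNorm p t P ≤ D * B * t ^ (D - 1) := by
  have ht0 : 0 ≤ t := zero_le_one.trans ht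
  conv_lhs => rw [P.as_sum_range' D hD]
  refine (polyNorm_sum_le p ht0 _ _).trans ?_
  have hterm : ∀ j ∈ Finset.range D, polyNorm p t (monomial j (P.coeff j)) ≤ B * t ^ (D - 1) := by
    intro j hj
    rw [polyNorm_monomial]
    have hj' := Finset.mem_range.1 hj
    exact mul_le_mul (h j) (pow_le_pow_right₀ ht (by omega)) (pow_nonneg ht0 _) hB
  refine (Finset.sum_le_sum hterm).trans ?_
  rw [Finset.sum_const, Finset.card_range, nsmul_eq_mul, mul_assoc]

/-- `rnorm r ≤ d · (2d−1)! d^{2d−2} · 2^{d−1}` for Kaltofen's `r = cof`. [cite: Kaltofen1995, §3 Thm. 3] -/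
theorem rnorm_cof_le (hd : d ≠ 0) :
    rnorm (l1Seminorm (ℕ × ℕ)) 2 (red_genPoly_monic d) (cof (genPoly d) d) ≤
      d * ((d + (d - 1)).factorial * (d : ℝ) ^ (d + (d - 1) - 1)) * (2 : ℝ) ^ (d - 1) := by
  rw [cof]
  refine (rnorm_mk_le _ _ (by norm_num) (polyNorm_red_genPoly_tail_le d) _).trans ?_
  rcases natDegree_cofPoly_lt d hd with h | h
  · refine polyNorm_le_of_coeff_le _ (by norm_num) _ _ (by positivity) d h fun j => ?_
    rw [l1Seminorm_apply]; exact l1Norm_coeff_cofPoly_le d hd j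
  · rw [h, polyNorm_zero]; positivity

end Rho

/-! ### The Taylor data `F_{j,i}` -/

section Tayl

variable (d : ℕ)

/-- The Taylor data of the generic polynomial: `F_{j,i} = Σ_{n ≤ d−i} C(n+i, i) c_{n+i,j} z̄ⁿ`
(with `c_{d,0} = 1`). [cite: Kaltofen1995, §3 (proof of Thm. 2)] -/
theorem coeff_tayl_genPoly (i j : ℕ) :
    (tayl (genPoly d) i).coeff j = ∑ n ∈ Finset.range (d + 1),
      ((n + i).choose i : Rt (genPoly d)) *
        (algebraMap GenCoeff (Rt (genPoly d)) (((genPoly d).coeff (n + i)).coeff j) * zbar (genPoly d) ^ n) := by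
  rw [tayl]
  have hdeg : (hasseDeriv i (liftR (genPoly d))).natDegree < d + 1 := by
    refine (natDegree_hasseDeriv_le _ _).trans_lt ?_
    have : (liftR (genPoly d)).natDegree ≤ d := by
      rw [liftR]; exact (natDegree_map_le).trans (natDegree_genPoly d).le
    omega
  rw [eval_eq_sum_range' hdeg, finsetSum_coeff]
  refine Finset.sum_congr rfl fun n _ => ?_
  rw [hasseDeriv_coeff, ← C_pow, coeff_mul_C,
    ← map_natCast (C : Rt (genPoly d) →+* Polynomial (Rt (genPoly d))) ((n + i).choose i), coeff_C_mul]
  simp only [coeff_map, coe_mapRingHom]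
  ring

/-- `rdeg F_{j,i} ≤ d` for the Taylor data of the generic polynomial. [cite: Kaltofen1995, §3 Thm. 2] -/
theorem rdeg_coeff_tayl_le (i j : ℕ) :
    rdeg (red_genPoly_monic d) ((tayl (genPoly d) i).coeff j) ≤ d := by
  have hfw := wdeg_red_genPoly_le d
  rw [coeff_tayl_genPoly]
  refine (rdeg_sum_le _ _ _).trans (Finset.sup_le fun n hn => ?_)
  have hn' : n < d + 1 := Finset.mem_range.1 hn
  refine (rdeg_mul_le _ hfw _ _).trans ?_
  rw [rdeg_natCast _ hfw, zero_add]
  refine (rdeg_mul_le _ hfw _ _).trans ?_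
  by_cases hni : n + i ≤ d
  · have h1 : rdeg (red_genPoly_monic d)
        (algebraMap GenCoeff (Rt (genPoly d)) (((genPoly d).coeff (n + i)).coeff j)) ≤
        (((genPoly d).coeff (n + i)).coeff j).totalDegree :=
      rdeg_algebraMap_le (red_genPoly_monic d) hfw (((genPoly d).coeff (n + i)).coeff j)
    have h2 : rdeg (red_genPoly_monic d) (zbar (genPoly d) ^ n) ≤ n := rdeg_root_pow_le (red_genPoly_monic d) hfw n
    have h3 := totalDegree_coeff_coeff_genPoly_add_le d (n + i) j hni
    omega
  · rw [coeff_genPoly_eq_zero d (by omega), coeff_zero, map_zero, rdeg_zero, zero_add]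
    have h2 : rdeg (red_genPoly_monic d) (zbar (genPoly d) ^ n) ≤ n := rdeg_root_pow_le (red_genPoly_monic d) hfw n
    omega

/-- `rnorm F_{j,i} ≤ (d+1) · 2^d · 2^d` (crudely: binomials `≤ 2^d`, `‖c‖ ≤ 1`, `‖z̄ⁿ‖₂ ≤ 2ⁿ`).
[cite: Kaltofen1995, §3 Thm. 2] -/
theorem rnorm_coeff_tayl_le (i j : ℕ) :
    rnorm (l1Seminorm (ℕ × ℕ)) 2 (red_genPoly_monic d) ((tayl (genPoly d) i).coeff j) ≤
      (d + 1) * ((2 : ℝ) ^ (d + i) * (2 : ℝ) ^ d) := by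
  have hfn := polyNorm_red_genPoly_tail_le d
  have h1 : l1Seminorm (ℕ × ℕ) 1 ≤ 1 := by rw [l1Seminorm_one]
  rw [coeff_tayl_genPoly]
  refine (rnorm_sum_le _ _ (by norm_num) _ _).trans ?_
  have hterm : ∀ n ∈ Finset.range (d + 1),
      rnorm (l1Seminorm (ℕ × ℕ)) 2 (red_genPoly_monic d) (((n + i).choose i : Rt (genPoly d)) *
        (algebraMap GenCoeff (Rt (genPoly d)) (((genPoly d).coeff (n + i)).coeff j) * zbar (genPoly d) ^ n))
        ≤ (2 : ℝ) ^ (d + i) * (2 : ℝ) ^ d := by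
    intro n hn
    have hn' := Finset.mem_range.1 hn
    refine (rnorm_mul_le _ _ (by norm_num) hfn _ _).trans ?_
    refine mul_le_mul ?_ ?_ (rnorm_nonneg _ _ (by norm_num) _) (by positivity)
    · refine (rnorm_natCast_le _ _ (by norm_num) hfn _).trans ?_
      rw [l1Seminorm_apply, ← map_natCast (MvPolynomial.C : ℤ →+* GenCoeff), l1Norm_C, Int.natAbs_natCast]
      calc (((n + i).choose i : ℕ) : ℝ) ≤ ((2 ^ (n + i) : ℕ) : ℝ) := by exact_mod_cast Nat.choose_le_two_pow _ _
        _ = (2 : ℝ) ^ (n + i) := by push_cast; ring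
        _ ≤ 2 ^ (d + i) := pow_le_pow_right₀ (by norm_num) (by omega)
    · refine (rnorm_mul_le _ _ (by norm_num) hfn _ _).trans ?_
      have ha : rnorm (l1Seminorm (ℕ × ℕ)) 2 (red_genPoly_monic d)
          (algebraMap GenCoeff (Rt (genPoly d)) (((genPoly d).coeff (n + i)).coeff j)) ≤ 1 := by
        refine (rnorm_algebraMap_le _ _ (by norm_num) hfn _).trans ?_
        rw [l1Seminorm_apply]; exact_mod_cast l1Norm_coeff_coeff_genPoly_le d (n + i) j
      have hb : rnorm (l1Seminorm (ℕ × ℕ)) 2 (red_genPoly_monic d) (zbar (genPoly d) ^ n) ≤ (2 : ℝ) ^ d := by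
        rw [zbar]
        exact (rnorm_root_pow_le _ _ (by norm_num) hfn h1 n).trans (pow_le_pow_right₀ (by norm_num) (by omega))
      calc _ ≤ 1 * (2 : ℝ) ^ d := mul_le_mul ha hb (rnorm_nonneg _ _ (by norm_num) _) zero_le_one
        _ = 2 ^ d := one_mul _
  refine (Finset.sum_le_sum hterm).trans (le_of_eq ?_)
  rw [Finset.sum_const, Finset.card_range, nsmul_eq_mul]
  push_cast
  ring

end Tayl

end Literature.RingTheory.MvPolynomial.KaltofenBounds

end

/-!
# Part II — degrees along the scaled Newton iteration

Support file for the proof of Kaltofen's Theorem 7 (`kaltofen1995_thm7`; E. Kaltofen, *Effective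
Noether irreducibility forms and applications*, J. Comput. System Sci. 50 (1995) 274–295, §3,
Thms. 1, 2 and the entries of the matrix (29)), for the objects of `KaltofenTestDefs`
(namespace `KaltofenAIT`) on the generic polynomial `genPoly d`.

Kaltofen's Thm. 1 bounds `deg ρ^{2k−1} a_k` linearly in `k`; Thm. 2 does the same for the
powers `a_k^{(i)}`. In the division-free organisation of `KaltofenTestDefs` the Newton iterates
`newtonSeq (natF P d e) m` (whose `Y^k`-coefficients are the `ρ^{2k−1} a_k`) satisfy
`a_{m+1} = −r · G(a_m, Y)` (`newtonSeq_natF_succ`), are divisible by `Y`, and writing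
`a_m = Y · ε_m` the slope-`A` defect `sdeg` of `KaltofenBoundsDegreeTools` of `ε_m` stays bounded:

* `newtonSeq_natF_coeff_zero_and_sdeg`: `sdeg_{8d−6} ε_m ≤ 4d − 3` for all `m`
  (i.e. `rdeg [Y^k] a_m ≤ (8d−6)(k−1) + 4d − 3`), the heart being the elementary inequality
  `key_ineq` between Kaltofen's constants;
* `powA_coeff_zero_and_sdeg`: the same for Kaltofen's recursion (27) for the powers;
* `rdeg_entryR_le`, `totalDegree_kMatrix_le`: the entries of row `(k, j)` of the matrix (29)
  have degree `≤ (8d−6)·k` (`≤ 2d − 2` for `k = 0`).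

The slope `8d − 6` (instead of Kaltofen's `6d − 4`) is the price of the coarser valuation
bookkeeping; the minors still meet the budget of Thm. 4 (Part III of this file).

No new definitions, no named facts.

## References

* E. Kaltofen, J. Comput. System Sci. 50 (1995) 274–295, §3 Thms. 1, 2, eq. (27)–(29).
  [Kaltofen1995]
-/

noncomputable section

open Polynomial

namespace Literature.RingTheory.MvPolynomial.KaltofenBounds

open Literature.RingTheory.MvPolynomial.KaltofenAIT

universe u

/-! ### The Newton step in closed form -/

section NewtonStep

variable {A : Type u} [CommRing A] (P : Polynomial (Polynomial A)) (d e : ℕ)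

/-- `F♮(a) = a + r · G(a)`. [cite: Kaltofen1995, §2 Step N] -/
theorem eval_natF (a : Polynomial (Rt P)) :
    (natF P d e).eval a = a + C (cof P d) * (bigG P d e).eval a := by
  rw [natF, eval_add, eval_X, eval_mul, eval_C]

/-- The simplified Newton step for `F♮ = u + r G` is the fixed-point iteration
`a_{m+1} = −r · G(a_m, Y)`. [cite: Kaltofen1995, §2 Step N, §3 (7)–(10)] -/
theorem newtonSeq_natF_succ (m : ℕ) :
    newtonSeq (natF P d e) (m + 1) = -(C (cof P d) * (bigG P d e).eval (newtonSeq (natF P d e) m)) := by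
  rw [newtonSeq, eval_natF]; ring

/-- `G(Y ε, Y) = Y · Σ_{(i,j) ≠ (0,0),(1,0)} Y^{i+j−1} (F_{j,i} ρ^{i+2j−2}) εⁱ`: every term of `G` has
`u`-order plus `Y`-order at least one. [cite: Kaltofen1995, §3 (7)] -/
theorem eval_bigG_X_mul (ε : Polynomial (Rt P)) :
    (bigG P d e).eval (X * ε) = X * ∑ i ∈ Finset.range (d + 1), ∑ j ∈ Finset.range (e + 1),
      if (i = 0 ∧ j = 0) ∨ (i = 1 ∧ j = 0) then 0
      else X ^ (i + j - 1) * (C ((tayl P i).coeff j * rhoR P d ^ (i + 2 * j - 2)) * ε ^ i) := by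
  rw [bigG, eval_finsetSum, Finset.mul_sum]
  refine Finset.sum_congr rfl fun i _ => ?_
  rw [eval_finsetSum, Finset.mul_sum]
  refine Finset.sum_congr rfl fun j _ => ?_
  split_ifs with h
  · rw [eval_zero, mul_zero]
  · rw [eval_mul, eval_pow, eval_X, eval_C, mul_pow]
    obtain ⟨s, hs⟩ : ∃ s, i + j = s + 1 := ⟨i + j - 1, by omega⟩
    rw [show i + j - 1 = s by omega]
    have hX : (X : Polynomial (Rt P)) ^ j * X ^ i = X * X ^ s := by
      rw [← pow_add, add_comm, hs, pow_succ']
    linear_combination (C ((tayl P i).coeff j * rhoR P d ^ (i + 2 * j - 2)) * ε ^ i) * hX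

/-- `divX (Y · Q) = Q`. [folklore] -/
theorem divX_X_mul {R : Type*} [CommRing R] (Q : R[X]) : divX (X * Q) = Q := by
  ext n
  rw [coeff_divX, X_mul, coeff_mul_X]

/-- A polynomial with vanishing constant term is `Y · divX`. [folklore] -/
theorem eq_X_mul_divX {R : Type*} [CommRing R] (Q : R[X]) (h : Q.coeff 0 = 0) : Q = X * divX Q := by
  conv_lhs => rw [← X_mul_divX_add Q, h, map_zero, add_zero]

end NewtonStep

/-! ### Kaltofen's constants: the key inequalities -/

section Arith

/-- The inequality that closes the degree induction of Thm. 1 with slope `8d − 6` and intercept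
`4d − 3`: for `(i, j) ∉ {(0,0), (1,0)}`,
`d + (i+2j−2)(2d−1) + i(4d−3) ≤ d + (8d−6)(i+j−1)` (the difference is `(2d−2)(i+2j−2)`).
[folklore] -/
theorem key_ineq (d i j : ℕ) (hd : 1 ≤ d) (hij : ¬(i = 0 ∧ j = 0 ∨ i = 1 ∧ j = 0)) :
    d + (i + 2 * j - 2) * (d + (d - 1)) + i * (4 * d - 3) ≤ d + (8 * d - 6) * (i + j - 1) := by
  obtain ⟨d', rfl⟩ : ∃ d', d = d' + 1 := ⟨d - 1, by omega⟩
  obtain ⟨s, hs⟩ : ∃ s, i + j = s + 1 := ⟨i + j - 1, by omega⟩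
  obtain ⟨u, hu⟩ : ∃ u, i + 2 * j = u + 2 := ⟨i + 2 * j - 2, by omega⟩
  have hui : u + i = 2 * s := by omega
  rw [show i + 2 * j - 2 = u by omega, show i + j - 1 = s by omega,
    show d' + 1 + (d' + 1 - 1) = 2 * d' + 1 by omega, show 4 * (d' + 1) - 3 = 4 * d' + 1 by omega,
    show 8 * (d' + 1) - 6 = 2 * (4 * d' + 1) by omega]
  have h1 : u * (2 * d' + 1) ≤ u * (4 * d' + 1) := Nat.mul_le_mul_left u (by omega)
  calc d' + 1 + u * (2 * d' + 1) + i * (4 * d' + 1)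
      ≤ d' + 1 + (u * (4 * d' + 1) + i * (4 * d' + 1)) := by omega
    _ = d' + 1 + 2 * (4 * d' + 1) * s := by rw [← add_mul, hui]; ring

/-- The inequality behind the recursion (27) for the powers: `(2d−1) + ((4d−3) + ((4d−3)+i−1) ∸ (8d−6)) ≤ (4d−3) + i`.
[folklore] -/
theorem powA_ineq (d i : ℕ) (hd : 1 ≤ d) :
    (d + (d - 1)) + ((4 * d - 3) + ((4 * d - 3) + i - 1) - (8 * d - 6)) ≤ (4 * d - 3) + i := by
  omega

/-- Row `k`, column `(i, l, ι)` with `l < k`: `2l(2d−1) + (8d−6)(k−l−1) + (4d−3) + i − 1 + ι ≤ (8d−6)k`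
for `i, ι < d`, `2 ≤ d`. [folklore] -/
theorem entry_ineq_lt (d k l i ι : ℕ) (hd : 2 ≤ d) (hl : l < k) (hi : i < d) (hι : ι < d) :
    2 * l * (d + (d - 1)) + ((8 * d - 6) * (k - l - 1) + ((4 * d - 3) + i - 1)) + ι ≤ (8 * d - 6) * k := by
  obtain ⟨d', rfl⟩ : ∃ d', d = d' + 2 := ⟨d - 2, by omega⟩
  obtain ⟨t, rfl⟩ : ∃ t, k = l + 1 + t := ⟨k - l - 1, by omega⟩
  rw [show l + 1 + t - l - 1 = t by omega, show d' + 2 + (d' + 2 - 1) = 2 * d' + 3 by omega,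
    show 8 * (d' + 2) - 6 = 8 * d' + 10 by omega, show 4 * (d' + 2) - 3 + i - 1 = 4 * d' + 4 + i by omega]
  have h1 : 2 * l * (2 * d' + 3) ≤ (8 * d' + 10) * l := by nlinarith
  have h2 : 4 * d' + 4 + i + ι ≤ 8 * d' + 10 := by omega
  nlinarith [h1, h2]

/-- Row `k ≥ 1`, column `(i, k, ι)`: `(2k−1)(2d−1) + (i + ι) ≤ (8d−6)k` for `i, ι < d`. [folklore] -/
theorem entry_ineq_eq (d k i ι : ℕ) (hd : 1 ≤ d) (hk : 1 ≤ k) (hi : i < d) (hι : ι < d) :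
    (2 * k - 1) * (d + (d - 1)) + (i + ι) ≤ (8 * d - 6) * k := by
  obtain ⟨d', rfl⟩ : ∃ d', d = d' + 1 := ⟨d - 1, by omega⟩
  obtain ⟨k', rfl⟩ : ∃ k', k = k' + 1 := ⟨k - 1, by omega⟩
  rw [show 2 * (k' + 1) - 1 = 2 * k' + 1 by omega, show d' + 1 + (d' + 1 - 1) = 2 * d' + 1 by omega,
    show 8 * (d' + 1) - 6 = 8 * d' + 2 by omega]
  nlinarith

end Arith

/-! ### Thm. 1: the degrees along the Newton iteration -/

section Newton

variable (d e : ℕ)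

/-- `rdeg (F_{j,i} ρ^{i+2j−2}) ≤ d + (i+2j−2)(2d−1)`. [cite: Kaltofen1995, §3 Thm. 1] -/
theorem rdeg_tayl_mul_rho_pow_le (i j : ℕ) :
    rdeg (red_genPoly_monic d) ((tayl (genPoly d) i).coeff j * rhoR (genPoly d) d ^ (i + 2 * j - 2)) ≤
      d + (i + 2 * j - 2) * (d + (d - 1)) := by
  have hfw := wdeg_red_genPoly_le d
  refine (rdeg_mul_le _ hfw _ _).trans (add_le_add (rdeg_coeff_tayl_le d i j) ?_)
  refine (rdeg_pow_le _ hfw _ _).trans (Nat.mul_le_mul_left _ ?_)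
  exact (rdeg_algebraMap_le _ hfw _).trans (totalDegree_rres_le d)

/-- **Kaltofen's Thm. 1 (degrees), inductive form.** Every Newton iterate `a_m` is divisible by
`Y`, and `ε_m = a_m / Y` has slope-`(8d−6)` defect `≤ 4d − 3`: `rdeg [Y^k] a_m ≤ (8d−6)(k−1) + 4d−3`
for `k ≥ 1`. [cite: Kaltofen1995, §3 Thm. 1] -/
theorem newtonSeq_natF_coeff_zero_and_sdeg (hd : 1 ≤ d) (m : ℕ) :
    (newtonSeq (natF (genPoly d) d e) m).coeff 0 = 0 ∧
      sdeg (red_genPoly_monic d) (8 * d - 6) (divX (newtonSeq (natF (genPoly d) d e) m)) ≤ 4 * d - 3 := by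
  have hfw := wdeg_red_genPoly_le d
  induction m with
  | zero =>
    refine ⟨by rw [newtonSeq, coeff_zero], ?_⟩
    rw [newtonSeq, divX_zero, sdeg_zero]; exact Nat.zero_le _
  | succ m ih =>
    obtain ⟨ih0, ihs⟩ := ih
    set a := newtonSeq (natF (genPoly d) d e) m with ha
    set ε := divX a with hε
    have haε : a = X * ε := eq_X_mul_divX a ih0
    set G' := ∑ i ∈ Finset.range (d + 1), ∑ j ∈ Finset.range (e + 1),
      if (i = 0 ∧ j = 0) ∨ (i = 1 ∧ j = 0) then (0 : Polynomial (Rt (genPoly d)))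
      else X ^ (i + j - 1) * (C ((tayl (genPoly d) i).coeff j * rhoR (genPoly d) d ^ (i + 2 * j - 2)) * ε ^ i)
      with hG'
    have hstep : newtonSeq (natF (genPoly d) d e) (m + 1) = X * (-(C (cof (genPoly d) d) * G')) := by
      rw [newtonSeq_natF_succ, ← ha, haε, eval_bigG_X_mul, ← hG']; ring
    refine ⟨by rw [hstep, coeff_X_mul_zero], ?_⟩
    rw [hstep, divX_X_mul, sdeg_neg]
    refine (sdeg_C_mul_le _ _ hfw _ _).trans ?_
    have hG'le : sdeg (red_genPoly_monic d) (8 * d - 6) G' ≤ d := by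
      rw [hG']
      refine (sdeg_sum_le _ _ _ _).trans (Finset.sup_le fun i hi => ?_)
      refine (sdeg_sum_le _ _ _ _).trans (Finset.sup_le fun j hj => ?_)
      split_ifs with hij
      · rw [sdeg_zero]; exact Nat.zero_le _
      · refine (sdeg_X_pow_mul_le _ _ _ _).trans ?_
        refine tsub_le_iff_right.2 ?_
        refine (sdeg_C_mul_le _ _ hfw _ _).trans ?_
        refine (add_le_add (rdeg_tayl_mul_rho_pow_le d i j)
          ((sdeg_pow_le _ _ hfw _ _).trans (Nat.mul_le_mul_left i ihs))).trans ?_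
        exact key_ineq d i j hd hij
    have hr := rdeg_cof_le d (by omega)
    omega

/-- **Kaltofen's Thm. 1 (degrees):** `rdeg [Y^k] δ̄_K ≤ (8d−6)(k−1) + (4d−3)` for `k ≥ 1`, and
`[Y^0] δ̄_K = 0`. [cite: Kaltofen1995, §3 Thm. 1] -/
theorem rdeg_coeff_deltaBar_le (hd : 1 ≤ d) (K k : ℕ) (hk : 1 ≤ k) :
    rdeg (red_genPoly_monic d) ((deltaBar (genPoly d) d e K).coeff k) ≤ (8 * d - 6) * (k - 1) + (4 * d - 3) := by
  obtain ⟨h0, hs⟩ := newtonSeq_natF_coeff_zero_and_sdeg d e hd K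
  rw [deltaBar]
  have := rdeg_coeff_le_sdeg (red_genPoly_monic d) (8 * d - 6) (divX (newtonSeq (natF (genPoly d) d e) K)) (k - 1)
  rw [coeff_divX, Nat.sub_add_cancel hk] at this
  exact this.trans (add_le_add le_rfl hs)

/-! ### Thm. 2: the powers `A_i` -/

/-- **Kaltofen's Thm. 2 (degrees), inductive form** for the recursion (27): `A_i` is divisible by
`Y` and `A_i / Y` has slope-`(8d−6)` defect `≤ (4d−3) + i − 1`. [cite: Kaltofen1995, §3 Thm. 2, (27)] -/
theorem powA_coeff_zero_and_sdeg (hd : 1 ≤ d) (K i : ℕ) :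
    (powA (genPoly d) d e K i).coeff 0 = 0 ∧
      sdeg (red_genPoly_monic d) (8 * d - 6) (divX (powA (genPoly d) d e K i)) ≤ (4 * d - 3) + i - 1 := by
  have hfw := wdeg_red_genPoly_le d
  obtain ⟨hδ0, hδs⟩ := newtonSeq_natF_coeff_zero_and_sdeg d e hd K
  rw [← deltaBar] at hδ0 hδs
  set ε := divX (deltaBar (genPoly d) d e K) with hε
  have hδ : deltaBar (genPoly d) d e K = X * ε := eq_X_mul_divX _ hδ0
  induction i with
  | zero =>
    refine ⟨by rw [powA, coeff_zero], ?_⟩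
    rw [powA, divX_zero, sdeg_zero]; exact Nat.zero_le _
  | succ i ih =>
    obtain ⟨ih0, ihs⟩ := ih
    set π := divX (powA (genPoly d) d e K i) with hπ
    have hAπ : powA (genPoly d) d e K i = X * π := eq_X_mul_divX _ ih0
    have hstep : powA (genPoly d) d e K (i + 1) =
        X * (C (zbar (genPoly d)) * π + C (zbar (genPoly d) ^ i) * ε +
          C (rhoR (genPoly d) d) * (X * (ε * π))) := by
      rw [powA, hAπ, hδ]; ring
    refine ⟨by rw [hstep, coeff_X_mul_zero], ?_⟩
    rw [hstep, divX_X_mul]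
    refine (sdeg_add_le _ _ _ _).trans (max_le ((sdeg_add_le _ _ _ _).trans (max_le ?_ ?_)) ?_)
    · refine (sdeg_C_mul_le _ _ hfw _ _).trans ?_
      have h1 := rdeg_root_le (red_genPoly_monic d) hfw
      rw [zbar]
      have hc0 : 1 ≤ 4 * d - 3 := by omega
      omega
    · refine (sdeg_C_mul_le _ _ hfw _ _).trans ?_
      have h1 := rdeg_root_pow_le (red_genPoly_monic d) hfw i
      rw [zbar]
      omega
    · refine (sdeg_C_mul_le _ _ hfw _ _).trans ?_
      refine (add_le_add ((rdeg_algebraMap_le _ hfw _).trans (totalDegree_rres_le d))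
        ((sdeg_X_mul_le _ _ _).trans (tsub_le_tsub_right ((sdeg_mul_le _ _ hfw _ _).trans
          (add_le_add hδs ihs)) _))).trans ?_
      exact powA_ineq d i hd

/-- **Kaltofen's Thm. 2 (degrees):** `rdeg [Y^k] A_i ≤ (8d−6)(k−1) + (4d−3) + i − 1` for `k ≥ 1`.
[cite: Kaltofen1995, §3 Thm. 2] -/
theorem rdeg_coeff_powA_le (hd : 1 ≤ d) (K i k : ℕ) (hk : 1 ≤ k) :
    rdeg (red_genPoly_monic d) ((powA (genPoly d) d e K i).coeff k) ≤
      (8 * d - 6) * (k - 1) + ((4 * d - 3) + i - 1) := by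
  obtain ⟨h0, hs⟩ := powA_coeff_zero_and_sdeg d e hd K i
  have := rdeg_coeff_le_sdeg (red_genPoly_monic d) (8 * d - 6) (divX (powA (genPoly d) d e K i)) (k - 1)
  rw [coeff_divX, Nat.sub_add_cancel hk] at this
  exact this.trans (add_le_add le_rfl hs)

/-! ### The entries of the matrix (29) -/

/-- The entries of Kaltofen's system (29), row `k`, column `(i, l, ι)` (`i, ι < d`): `rdeg ≤ (8d−6)k`,
and `≤ 2d − 2` in row `k = 0`. [cite: Kaltofen1995, §3 (29), Thm. 4] -/
theorem rdeg_entryR_le (hd : 2 ≤ d) (K k : ℕ) (c : ℕ × ℕ × ℕ) (hc1 : c.1 < d) (hc3 : c.2.2 < d) :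
    rdeg (red_genPoly_monic d) (entryR (genPoly d) d e K k c) ≤
      (8 * d - 6) * k + (if k = 0 then 2 * d - 2 else 0) := by
  have hfw := wdeg_red_genPoly_le d
  have hρ : rdeg (red_genPoly_monic d) (rhoR (genPoly d) d) ≤ d + (d - 1) :=
    (rdeg_algebraMap_le _ hfw _).trans (totalDegree_rres_le d)
  rw [entryR]
  by_cases hlt : c.2.1 < k
  · rw [if_pos hlt, if_neg (show ¬k = 0 by omega), add_zero]
    calc rdeg (red_genPoly_monic d) (rhoR (genPoly d) d ^ (2 * c.2.1) *
          (powA (genPoly d) d e K c.1).coeff (k - c.2.1) * zbar (genPoly d) ^ c.2.2)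
        ≤ rdeg (red_genPoly_monic d) (rhoR (genPoly d) d ^ (2 * c.2.1) *
            (powA (genPoly d) d e K c.1).coeff (k - c.2.1)) + rdeg (red_genPoly_monic d) (zbar (genPoly d) ^ c.2.2) :=
          rdeg_mul_le _ hfw _ _
      _ ≤ (2 * c.2.1 * (d + (d - 1)) + ((8 * d - 6) * (k - c.2.1 - 1) + ((4 * d - 3) + c.1 - 1))) + c.2.2 := by
          refine add_le_add ((rdeg_mul_le _ hfw _ _).trans (add_le_add ?_ ?_)) (rdeg_root_pow_le _ hfw c.2.2)
          · exact (rdeg_pow_le _ hfw _ _).trans (Nat.mul_le_mul_left _ hρ)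
          · exact rdeg_coeff_powA_le d e (by omega) K c.1 (k - c.2.1) (by omega)
      _ ≤ (8 * d - 6) * k := entry_ineq_lt d k c.2.1 c.1 c.2.2 hd hlt hc1 hc3
  · rw [if_neg hlt]
    by_cases hk : c.2.1 = k
    · rw [if_pos hk]
      by_cases h0 : k = 0
      · subst h0
        rw [if_pos rfl, show 2 * 0 - 1 = 0 from rfl, pow_zero, one_mul, mul_zero, zero_add]
        refine (rdeg_root_pow_le _ hfw _).trans ?_
        omega
      · rw [if_neg h0, add_zero]
        refine (rdeg_mul_le _ hfw _ _).trans ?_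
        refine (add_le_add ((rdeg_pow_le _ hfw _ _).trans (Nat.mul_le_mul_left _ hρ))
          (rdeg_root_pow_le _ hfw _)).trans ?_
        exact entry_ineq_eq d k c.1 c.2.2 (by omega) (by omega) hc1 hc3
    · rw [if_neg hk, rdeg_zero]; exact Nat.zero_le _

/-- The entries of Kaltofen's matrix (29) over `ℤ[c]`: row `(k, j)` has total degree `≤ (8d−6)k`
(`≤ 2d − 2` for `k = 0`). [cite: Kaltofen1995, §3 (29), Thm. 4] -/
theorem totalDegree_kMatrix_le (hd : 2 ≤ d) (K ℓ : ℕ) (r : Fin (ℓ + 1) × Fin d) (c : Fin d × Fin (e + 1) × Fin d) :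
    (kMatrix (genPoly d) d e K (red_genPoly_monic d) ℓ r c).totalDegree ≤
      (8 * d - 6) * (r.1 : ℕ) + (if (r.1 : ℕ) = 0 then 2 * d - 2 else 0) := by
  rw [kMatrix]
  exact (totalDegree_coeff_modByMonicHom_le _ _ _).trans
    (rdeg_entryR_le d e hd K r.1 ((c.1 : ℕ), (c.2.1 : ℕ), (c.2.2 : ℕ)) c.1.is_lt c.2.2.is_lt)

end Newton

end Literature.RingTheory.MvPolynomial.KaltofenBounds

end

/-!
# Part III — the degree of the forms `Δ` (Thm. 4, degrees)

Support file for the proof of Kaltofen's Theorem 7 (`kaltofen1995_thm7`; E. Kaltofen, *Effective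
Noether irreducibility forms and applications*, J. Comput. System Sci. 50 (1995) 274–295, §3
Thm. 4): the maximal minors `genMinor d S` (`KaltofenTestDefs`) of the matrix (29) of the generic
polynomial satisfy Kaltofen's degree bound

  `deg genMinor d S ≤ 12d⁶ − 2d⁵ − 10d⁴ + 4d³ = 2d³(d+1)(2d−1)(3d−2)`   (`totalDegree_genMinor_le`).

With the row bound `(8d−6)·k` of Part II of this file for the rows `(k, j)` this needs
the observation that an `N × N` minor (`N = d²(d+1)`) uses each `k` at most `d` times, so that
`2 Σ k ≤ d·m·(2ℓ+1−m) = d²(d+1)(3d²−3d+1)` (`m = d(d+1)`, `ℓ = (2d−1)d`; the layer-cake estimate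
of `KaltofenBoundsMatrixTools`), while a minor with a repeated row vanishes.

No new definitions, no named facts.

## References

* E. Kaltofen, J. Comput. System Sci. 50 (1995) 274–295, §3 Thm. 4. [Kaltofen1995]
-/

noncomputable section

open Polynomial

namespace Literature.RingTheory.MvPolynomial.KaltofenBounds

open Literature.RingTheory.MvPolynomial.KaltofenAIT

/-! ### Arithmetic of Kaltofen's degree budget -/

section Arith

/-- Kaltofen's degree budget in closed form: `12d⁶ − 2d⁵ − 10d⁴ + 4d³ = 2d³(d+1)(2d−1)(3d−2)`,
written for `d = d' + 2`. [cite: Kaltofen1995, §3 Thm. 4] -/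
theorem kaltofenD_eq (d' : ℕ) :
    12 * (d' + 2) ^ 6 - 2 * (d' + 2) ^ 5 - 10 * (d' + 2) ^ 4 + 4 * (d' + 2) ^ 3 =
      2 * (d' + 2) ^ 3 * (d' + 3) * (2 * d' + 3) * (3 * d' + 4) := by
  have hD : 2 * (d' + 2) ^ 3 * (d' + 3) * (2 * d' + 3) * (3 * d' + 4) + 2 * (d' + 2) ^ 5 + 10 * (d' + 2) ^ 4 =
      12 * (d' + 2) ^ 6 + 4 * (d' + 2) ^ 3 := by ring
  have hge : 4 * (d' + 2) ^ 3 ≤ 2 * (d' + 2) ^ 3 * (d' + 3) * (2 * d' + 3) * (3 * d' + 4) := by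
    have h1 : 2 ≤ (d' + 3) * (2 * d' + 3) * (3 * d' + 4) :=
      calc 2 ≤ 3 * 3 * 4 := by norm_num
        _ ≤ (d' + 3) * (2 * d' + 3) * (3 * d' + 4) :=
          Nat.mul_le_mul (Nat.mul_le_mul (by omega) (by omega)) (by omega)
    calc 4 * (d' + 2) ^ 3 = 2 * (d' + 2) ^ 3 * 2 := by ring
      _ ≤ 2 * (d' + 2) ^ 3 * ((d' + 3) * (2 * d' + 3) * (3 * d' + 4)) := Nat.mul_le_mul_left _ h1
      _ = 2 * (d' + 2) ^ 3 * (d' + 3) * (2 * d' + 3) * (3 * d' + 4) := by ring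
  generalize 2 * (d' + 2) ^ 3 * (d' + 3) * (2 * d' + 3) * (3 * d' + 4) = D at hD hge
  generalize (d' + 2) ^ 6 = x6 at hD
  generalize (d' + 2) ^ 5 = x5 at hD
  generalize (d' + 2) ^ 4 = x4 at hD
  generalize (d' + 2) ^ 3 = x3 at hD hge
  omega

/-- The layer-cake bound in closed form: `d·m·(2ℓ+1−m) = (d'+2)²(d'+3)(3d'²+9d'+7)` for
`d = d'+2`, `m = d(d+1)`, `ℓ = (2d−1)d`. [folklore] -/
theorem layerCake_eq (d' : ℕ) :
    (d' + 2) * ((d' + 2 + 1) * (d' + 2)) * (2 * ((2 * (d' + 2) - 1) * (d' + 2)) + 1 - (d' + 2 + 1) * (d' + 2)) =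
      (d' + 2) ^ 2 * (d' + 3) * (3 * d' ^ 2 + 9 * d' + 7) := by
  have h : 2 * ((2 * (d' + 2) - 1) * (d' + 2)) + 1 - (d' + 2 + 1) * (d' + 2) = 3 * d' ^ 2 + 9 * d' + 7 := by
    rw [show 2 * (d' + 2) - 1 = 2 * d' + 3 by omega,
      show 2 * ((2 * d' + 3) * (d' + 2)) + 1 = (3 * d' ^ 2 + 9 * d' + 7) + (d' + 2 + 1) * (d' + 2) by ring,
      Nat.add_sub_cancel]
  rw [h]; ring

/-- The final degree arithmetic: from `2 Σk ≤ d·m·(2ℓ+1−m)` and `#(k = 0) ≤ d`,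
`(8d−6) Σk + (2d−2)·#(k=0) ≤ 12d⁶ − 2d⁵ − 10d⁴ + 4d³`. [folklore] -/
theorem degree_budget (d s n : ℕ) (hd : 2 ≤ d)
    (hs : 2 * s ≤ d * ((d + 1) * d) * (2 * ((2 * d - 1) * d) + 1 - (d + 1) * d)) (hn : n ≤ d) :
    (8 * d - 6) * s + (2 * d - 2) * n ≤ 12 * d ^ 6 - 2 * d ^ 5 - 10 * d ^ 4 + 4 * d ^ 3 := by
  obtain ⟨d', rfl⟩ : ∃ d', d = d' + 2 := ⟨d - 2, by omega⟩
  rw [layerCake_eq] at hs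
  rw [kaltofenD_eq, show 8 * (d' + 2) - 6 = 8 * d' + 10 by omega, show 2 * (d' + 2) - 2 = 2 * d' + 2 by omega]
  have h1 : (8 * d' + 10) * (2 * s) ≤ (8 * d' + 10) * ((d' + 2) ^ 2 * (d' + 3) * (3 * d' ^ 2 + 9 * d' + 7)) :=
    Nat.mul_le_mul_left _ hs
  have h2 : (2 * d' + 2) * n ≤ (2 * d' + 2) * (d' + 2) := Nat.mul_le_mul_left _ hn
  nlinarith [h1, h2, Nat.zero_le (d' ^ 2), Nat.zero_le (d' ^ 3), Nat.zero_le (d' ^ 4), Nat.zero_le (d' ^ 5),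
    Nat.zero_le d']

end Arith

/-! ### The minors -/

section Minor

variable (d : ℕ)

/-- The number of columns of Kaltofen's system with `l ≤ d`: `N = d·((d+1)·d)`. [cite: Kaltofen1995, §3 (29)] -/
theorem card_col : Fintype.card (Fin d × Fin (d + 1) × Fin d) = d * ((d + 1) * d) := by
  simp only [Fintype.card_prod, Fintype.card_fin]

/-- An injective choice of rows meets row `k = 0` at most `d` times. [folklore] -/
theorem card_filter_fst_eq_zero_le {ℓ e : ℕ} {C : Type*} [Fintype C] [DecidableEq C]
    (S : C → Fin (ℓ + 1) × Fin e) (hS : Function.Injective S) :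
    (Finset.univ.filter fun c : C => ((S c).1 : ℕ) = 0).card ≤ e := by
  classical
  have h := Finset.card_le_card_of_injOn (s := Finset.univ.filter fun c : C => ((S c).1 : ℕ) = 0)
    (t := (Finset.univ : Finset (Fin e))) (fun c : C => (S c).2) (fun c _ => Finset.mem_univ _) ?_
  · rwa [Finset.card_univ, Fintype.card_fin] at h
  · intro c₁ h₁ c₂ h₂ h12
    simp only [Finset.coe_filter, Finset.mem_univ, true_and, Set.mem_setOf_eq] at h₁ h₂
    apply hS
    refine Prod.ext (Fin.ext ?_) h12
    rw [h₁, h₂]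

/-- **Kaltofen's Thm. 4 (degree of the forms):** every maximal minor `Δ_S` of the matrix (29) of
the generic polynomial of degree `d ≥ 2` has `deg Δ_S ≤ 12d⁶ − 2d⁵ − 10d⁴ + 4d³`.
[cite: Kaltofen1995, §3 Thm. 4] -/
theorem totalDegree_genMinor_le (hd : 2 ≤ d)
    (S : Fin d × Fin (d + 1) × Fin d → Fin ((2 * d - 1) * d + 1) × Fin d) :
    (genMinor d S).totalDegree ≤ 12 * d ^ 6 - 2 * d ^ 5 - 10 * d ^ 4 + 4 * d ^ 3 := by
  classical
  by_cases hS : Function.Injective S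
  · rw [genMinor]
    refine (totalDegree_det_le_sum_rows _
      (fun c => (8 * d - 6) * ((S c).1 : ℕ) + (if ((S c).1 : ℕ) = 0 then 2 * d - 2 else 0))
      (fun c c' => ?_)).trans ?_
    · rw [Matrix.submatrix_apply, id]
      exact totalDegree_kMatrix_le d d hd _ _ (S c) c'
    · rw [Finset.sum_add_distrib, ← Finset.mul_sum, Finset.sum_ite, Finset.sum_const_zero, add_zero,
        Finset.sum_const, smul_eq_mul, mul_comm _ (2 * d - 2)]
      refine degree_budget d _ _ hd ?_ (card_filter_fst_eq_zero_le S hS)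
      refine two_mul_sum_fst_le S hS (card_col d) ?_
      exact Nat.mul_le_mul_right d (by omega)
  · obtain ⟨c, c', hcc', hne⟩ := Function.not_injective_iff.1 hS
    have h0 : genMinor d S = 0 := by
      rw [genMinor]
      refine Matrix.det_zero_of_row_eq hne ?_
      ext c''
      rw [Matrix.submatrix_apply, Matrix.submatrix_apply, hcc']
    rw [h0, MvPolynomial.totalDegree_zero]
    exact Nat.zero_le _

end Minor

end Literature.RingTheory.MvPolynomial.KaltofenBounds

end

/-!
# Part IV — norms along the scaled Newton iteration

Support file for the proof of Kaltofen's Theorem 7 (`kaltofen1995_thm7`; E. Kaltofen, *Effective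
Noether irreducibility forms and applications*, J. Comput. System Sci. 50 (1995) 274–295, §3,
Thms. 1–4, NORM half), for the objects of `KaltofenTestDefs` (namespace `KaltofenAIT`).

Kaltofen proves `‖ρ^{2k−1} a_k‖ ≤ C^k` by a Catalan-number induction (proof of Thm. 1). We use
instead the majorant device of `NoetherFormsToolkit`: for a ring seminorm `q` on
`R = A[z]/(P(z,0))` with `q 1 ≤ 1` and a small weight `τ` for `Y`, the weighted norm
`N_τ = polyNorm q τ` on `R[Y]` is submultiplicative, and the fixed-point form
`a_{m+1} = −r G(a_m, Y)` of the Newton iteration (`newtonSeq_natF_succ`) gives at once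

* `newtonSeq_natF_polyNorm_le`: if `q r ≤ M`, `q F_{j,i} ≤ Φ`, `q ρ ≤ ϱ` and
  `M · Σ_{(i,j)≠(0,0),(1,0)} τ^{i+j−1} Φ ϱ^{i+2j−2} cⁱ ≤ c`, then `N_τ(a_m / Y) ≤ c` for all `m`
  (hence `q [Y^k] a_m ≤ c τ^{1−k}`: geometric growth, Kaltofen's Thm. 1);
* `powA_polyNorm_le`: `N_τ(A_i / Y) ≤ (Z+2)ⁱ c` for the recursion (27) (`q z̄ ≤ Z`, `ϱ τ c ≤ 1`;
  Kaltofen's Thm. 2);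
* `seminorm_entryR_le`: the entries of row `k` of the matrix (29) have `q ≤ (Z+2)^d c Z^d / τ^k`.

Everything is stated for an arbitrary ring seminorm, so that the file is pure bookkeeping; the
instantiation for the generic polynomial (with `q` = the weighted `ℓ¹`-norm of
`KaltofenBoundsNormTools`, `τ⁻¹ = (2d)^{O(d)}`) is Part V of this file.

No new definitions, no named facts.

## References

* E. Kaltofen, J. Comput. System Sci. 50 (1995) 274–295, §3 Thms. 1, 2, 4, eq. (27)–(29).
  [Kaltofen1995]
-/

noncomputable section

open Polynomial

namespace Literature.RingTheory.MvPolynomial.KaltofenBounds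

open Literature.RingTheory.MvPolynomial.KaltofenAIT
open Literature.RingTheory.MvPolynomial.NoetherForms

universe u

section General

variable {S : Type u} [CommRing S] (q : RingSeminorm S)

/-- `q (aⁿ) ≤ (q a)ⁿ` for a ring seminorm with `q 1 ≤ 1`. [folklore] -/
theorem seminorm_pow_le (hq : q 1 ≤ 1) (a : S) (n : ℕ) : q (a ^ n) ≤ q a ^ n := by
  induction n with
  | zero => rw [pow_zero, pow_zero]; exact hq
  | succ n ih =>
    rw [pow_succ, pow_succ]
    exact (map_mul_le_mul q _ _).trans (mul_le_mul_of_nonneg_right ih (apply_nonneg q _))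

/-- `q (aⁿ) ≤ Bⁿ` from `q a ≤ B`. [folklore] -/
theorem seminorm_pow_le_of_le (hq : q 1 ≤ 1) {a : S} {B : ℝ} (h : q a ≤ B) (n : ℕ) : q (a ^ n) ≤ B ^ n :=
  (seminorm_pow_le q hq a n).trans (pow_le_pow_left₀ (apply_nonneg q _) h n)

variable {τ : ℝ}

/-- `N_τ(Y) ≤ τ`. [folklore] -/
theorem polyNorm_X_le (hq : q 1 ≤ 1) (hτ : 0 ≤ τ) : polyNorm q τ (X : S[X]) ≤ τ := by
  rw [← monomial_one_one_eq_X, polyNorm_monomial, pow_one]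
  exact mul_le_of_le_one_left hτ hq

/-- `N_τ(Yˢ Q) ≤ τˢ N_τ(Q)`. [folklore] -/
theorem polyNorm_X_pow_mul_le (hq : q 1 ≤ 1) (hτ : 0 ≤ τ) (s : ℕ) (Q : S[X]) :
    polyNorm q τ (X ^ s * Q) ≤ τ ^ s * polyNorm q τ Q := by
  refine (polyNorm_mul_le q hτ _ _).trans (mul_le_mul_of_nonneg_right ?_ (polyNorm_nonneg q hτ _))
  exact (polyNorm_pow_le q hτ hq _ _).trans (pow_le_pow_left₀ (polyNorm_nonneg q hτ _) (polyNorm_X_le q hq hτ) s)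

/-- `N_τ(Y Q) ≤ τ N_τ(Q)`. [folklore] -/
theorem polyNorm_X_mul_le (hq : q 1 ≤ 1) (hτ : 0 ≤ τ) (Q : S[X]) :
    polyNorm q τ (X * Q) ≤ τ * polyNorm q τ Q := by
  simpa using polyNorm_X_pow_mul_le q hq hτ 1 Q

/-- `N_τ(C a · Q) ≤ q a · N_τ(Q)`. [folklore] -/
theorem polyNorm_C_mul_le (hτ : 0 ≤ τ) (a : S) (Q : S[X]) :
    polyNorm q τ (C a * Q) ≤ q a * polyNorm q τ Q := by
  refine (polyNorm_mul_le q hτ _ _).trans ?_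
  rw [polyNorm_C]

/-- A coefficient is at most `N_τ / τ^k` (`τ > 0`). [folklore] -/
theorem seminorm_coeff_le_div (hτ : 0 < τ) (Q : S[X]) (k : ℕ) : q (Q.coeff k) ≤ polyNorm q τ Q / τ ^ k := by
  rw [le_div_iff₀ (pow_pos hτ k)]
  exact le_polyNorm q hτ.le Q k

end General

/-! ### Thm. 1 (norms): the Newton iteration -/

section Newton

variable {A : Type u} [CommRing A] (P : Polynomial (Polynomial A)) (d e : ℕ)
  (q : RingSeminorm (Rt P)) (hq : q 1 ≤ 1) {τ : ℝ} (hτ : 0 ≤ τ)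

include hq hτ

/-- **Kaltofen's Thm. 1 (norms), majorant form.** If `q r ≤ M`, `q F_{j,i} ≤ Φ` (`i ≤ d`, `j ≤ e`),
`q ρ ≤ ϱ` and the weight `τ` is so small that `M Σ_{(i,j)≠(0,0),(1,0)} τ^{i+j−1} Φ ϱ^{i+2j−2} cⁱ ≤ c`,
then every Newton iterate `a_m` is divisible by `Y` and `N_τ(a_m / Y) ≤ c`.
[cite: Kaltofen1995, §3 Thm. 1] -/
theorem newtonSeq_natF_polyNorm_le {M Φ ϱ c : ℝ} (hΦ0 : 0 ≤ Φ) (hϱ0 : 0 ≤ ϱ) (hc0 : 0 ≤ c)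
    (hM : q (cof P d) ≤ M)
    (hΦ : ∀ i ∈ Finset.range (d + 1), ∀ j ∈ Finset.range (e + 1), q ((tayl P i).coeff j) ≤ Φ)
    (hϱ : q (rhoR P d) ≤ ϱ)
    (hsmall : M * (∑ i ∈ Finset.range (d + 1), ∑ j ∈ Finset.range (e + 1),
      if (i = 0 ∧ j = 0) ∨ (i = 1 ∧ j = 0) then (0 : ℝ)
      else τ ^ (i + j - 1) * (Φ * ϱ ^ (i + 2 * j - 2)) * c ^ i) ≤ c) (m : ℕ) :
    (newtonSeq (natF P d e) m).coeff 0 = 0 ∧ polyNorm q τ (divX (newtonSeq (natF P d e) m)) ≤ c := by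
  have hM0 : 0 ≤ M := (apply_nonneg q _).trans hM
  induction m with
  | zero =>
    refine ⟨by rw [newtonSeq, coeff_zero], ?_⟩
    rw [newtonSeq, divX_zero, polyNorm_zero]; exact hc0
  | succ m ih =>
    obtain ⟨ih0, ihs⟩ := ih
    set a := newtonSeq (natF P d e) m with ha
    set ε := divX a with hε
    have haε : a = X * ε := eq_X_mul_divX a ih0
    set G' := ∑ i ∈ Finset.range (d + 1), ∑ j ∈ Finset.range (e + 1),
      if (i = 0 ∧ j = 0) ∨ (i = 1 ∧ j = 0) then (0 : Polynomial (Rt P))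
      else X ^ (i + j - 1) * (C ((tayl P i).coeff j * rhoR P d ^ (i + 2 * j - 2)) * ε ^ i) with hG'
    have hstep : newtonSeq (natF P d e) (m + 1) = X * (-(C (cof P d) * G')) := by
      rw [newtonSeq_natF_succ, ← ha, haε, eval_bigG_X_mul, ← hG']; ring
    refine ⟨by rw [hstep, coeff_X_mul_zero], ?_⟩
    rw [hstep, divX_X_mul, polyNorm_neg]
    refine (polyNorm_C_mul_le q hτ _ _).trans ?_
    have hεn : 0 ≤ polyNorm q τ ε := polyNorm_nonneg q hτ _
    have hG'le : polyNorm q τ G' ≤ ∑ i ∈ Finset.range (d + 1), ∑ j ∈ Finset.range (e + 1),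
        if (i = 0 ∧ j = 0) ∨ (i = 1 ∧ j = 0) then (0 : ℝ)
        else τ ^ (i + j - 1) * (Φ * ϱ ^ (i + 2 * j - 2)) * c ^ i := by
      rw [hG']
      refine (polyNorm_sum_le q hτ _ _).trans (Finset.sum_le_sum fun i hi => ?_)
      refine (polyNorm_sum_le q hτ _ _).trans (Finset.sum_le_sum fun j hj => ?_)
      split_ifs with hij
      · rw [polyNorm_zero]
      · refine (polyNorm_X_pow_mul_le q hq hτ _ _).trans ?_
        rw [mul_assoc]
        refine mul_le_mul_of_nonneg_left ?_ (pow_nonneg hτ _)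
        refine (polyNorm_C_mul_le q hτ _ _).trans ?_
        refine mul_le_mul ?_ ?_ (polyNorm_nonneg q hτ _) (mul_nonneg hΦ0 (pow_nonneg hϱ0 _))
        · exact (map_mul_le_mul q _ _).trans
            (mul_le_mul (hΦ i hi j hj) (seminorm_pow_le_of_le q hq hϱ _) (apply_nonneg q _) hΦ0)
        · exact (polyNorm_pow_le q hτ hq _ _).trans (pow_le_pow_left₀ hεn ihs i)
    calc q (cof P d) * polyNorm q τ G' ≤ M * polyNorm q τ G' :=
          mul_le_mul_of_nonneg_right hM (polyNorm_nonneg q hτ _)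
      _ ≤ M * _ := mul_le_mul_of_nonneg_left hG'le hM0
      _ ≤ c := hsmall

/-! ### Thm. 2 (norms): the powers -/

/-- **Kaltofen's Thm. 2 (norms), majorant form** for the recursion (27): with `q z̄ ≤ Z` and
`ϱ τ c ≤ 1`, `N_τ(A_i / Y) ≤ (Z + 2)ⁱ c`. [cite: Kaltofen1995, §3 Thm. 2, (27)] -/
theorem powA_polyNorm_le {M Φ ϱ c Z : ℝ} (hΦ0 : 0 ≤ Φ) (hϱ0 : 0 ≤ ϱ) (hc0 : 0 ≤ c) (hZ0 : 0 ≤ Z)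
    (hM : q (cof P d) ≤ M)
    (hΦ : ∀ i ∈ Finset.range (d + 1), ∀ j ∈ Finset.range (e + 1), q ((tayl P i).coeff j) ≤ Φ)
    (hϱ : q (rhoR P d) ≤ ϱ) (hZ : q (zbar P) ≤ Z) (hρτc : ϱ * τ * c ≤ 1)
    (hsmall : M * (∑ i ∈ Finset.range (d + 1), ∑ j ∈ Finset.range (e + 1),
      if (i = 0 ∧ j = 0) ∨ (i = 1 ∧ j = 0) then (0 : ℝ)
      else τ ^ (i + j - 1) * (Φ * ϱ ^ (i + 2 * j - 2)) * c ^ i) ≤ c) (K i : ℕ) :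
    (powA P d e K i).coeff 0 = 0 ∧ polyNorm q τ (divX (powA P d e K i)) ≤ (Z + 2) ^ i * c := by
  obtain ⟨hδ0, hδs⟩ := newtonSeq_natF_polyNorm_le P d e q hq hτ hΦ0 hϱ0 hc0 hM hΦ hϱ hsmall K
  rw [← deltaBar] at hδ0 hδs
  set ε := divX (deltaBar P d e K) with hε
  have hδ : deltaBar P d e K = X * ε := eq_X_mul_divX _ hδ0
  have hεn : 0 ≤ polyNorm q τ ε := polyNorm_nonneg q hτ _
  induction i with
  | zero =>
    refine ⟨by rw [powA, coeff_zero], ?_⟩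
    rw [powA, divX_zero, polyNorm_zero, pow_zero, one_mul]; exact hc0
  | succ i ih =>
    obtain ⟨ih0, ihs⟩ := ih
    set π := divX (powA P d e K i) with hπ
    have hAπ : powA P d e K i = X * π := eq_X_mul_divX _ ih0
    have hstep : powA P d e K (i + 1) =
        X * (C (zbar P) * π + C (zbar P ^ i) * ε + C (rhoR P d) * (X * (ε * π))) := by
      rw [powA, hAπ, hδ]; ring
    refine ⟨by rw [hstep, coeff_X_mul_zero], ?_⟩
    rw [hstep, divX_X_mul]
    have hπn : 0 ≤ polyNorm q τ π := polyNorm_nonneg q hτ _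
    have h1 : polyNorm q τ (C (zbar P) * π) ≤ Z * ((Z + 2) ^ i * c) :=
      (polyNorm_C_mul_le q hτ _ _).trans (mul_le_mul hZ ihs hπn hZ0)
    have h2 : polyNorm q τ (C (zbar P ^ i) * ε) ≤ Z ^ i * c :=
      (polyNorm_C_mul_le q hτ _ _).trans (mul_le_mul (seminorm_pow_le_of_le q hq hZ i) hδs hεn (pow_nonneg hZ0 _))
    have h3 : polyNorm q τ (C (rhoR P d) * (X * (ε * π))) ≤ (Z + 2) ^ i * c := by
      refine (polyNorm_C_mul_le q hτ _ _).trans ?_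
      refine (mul_le_mul hϱ ((polyNorm_X_mul_le q hq hτ _).trans (mul_le_mul_of_nonneg_left
        ((polyNorm_mul_le q hτ _ _).trans (mul_le_mul hδs ihs hπn hc0)) hτ))
        (polyNorm_nonneg q hτ _) hϱ0).trans ?_
      have hZ2 : 0 ≤ (Z + 2) ^ i * c := mul_nonneg (pow_nonneg (by linarith) _) hc0
      calc ϱ * (τ * (c * ((Z + 2) ^ i * c))) = (ϱ * τ * c) * ((Z + 2) ^ i * c) := by ring
        _ ≤ 1 * ((Z + 2) ^ i * c) := mul_le_mul_of_nonneg_right hρτc hZ2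
        _ = (Z + 2) ^ i * c := one_mul _
    refine ((polyNorm_add_le q hτ _ _).trans (add_le_add ((polyNorm_add_le q hτ _ _).trans
      (add_le_add h1 h2)) h3)).trans ?_
    have hZi : Z ^ i ≤ (Z + 2) ^ i := pow_le_pow_left₀ hZ0 (by linarith) i
    have key : Z ^ i * c ≤ (Z + 2) ^ i * c := mul_le_mul_of_nonneg_right hZi hc0
    have hexp : (Z + 2) ^ (i + 1) * c = Z * ((Z + 2) ^ i * c) + 2 * ((Z + 2) ^ i * c) := by ring
    rw [hexp]
    linarith

/-! ### The entries of the matrix (29) -/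

/-- The entries of Kaltofen's system (29), row `k`, column `(i, l, ι)` with `i, ι < d`, have
`q ≤ (Z+2)^d · c · Z^d / τ^k` (given `τ ≤ 1`, `Z, c, ϱ ≥ 1`, `ϱ² τ ≤ 1`, `ϱ τ c ≤ 1`).
[cite: Kaltofen1995, §3 (29), Thms. 3–4] -/
theorem seminorm_entryR_le {M Φ ϱ c Z : ℝ} (hτ0 : 0 < τ) (hτ1 : τ ≤ 1) (hΦ0 : 0 ≤ Φ) (hϱ1 : 1 ≤ ϱ)
    (hc1 : 1 ≤ c) (hZ1 : 1 ≤ Z)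
    (hM : q (cof P d) ≤ M)
    (hΦ : ∀ i ∈ Finset.range (d + 1), ∀ j ∈ Finset.range (e + 1), q ((tayl P i).coeff j) ≤ Φ)
    (hϱ : q (rhoR P d) ≤ ϱ) (hZ : q (zbar P) ≤ Z) (hρτ : ϱ ^ 2 * τ ≤ 1) (hρτc : ϱ * τ * c ≤ 1)
    (hsmall : M * (∑ i ∈ Finset.range (d + 1), ∑ j ∈ Finset.range (e + 1),
      if (i = 0 ∧ j = 0) ∨ (i = 1 ∧ j = 0) then (0 : ℝ)
      else τ ^ (i + j - 1) * (Φ * ϱ ^ (i + 2 * j - 2)) * c ^ i) ≤ c)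
    (K k : ℕ) (col : ℕ × ℕ × ℕ) (hcol1 : col.1 < d) (hcol3 : col.2.2 < d) :
    q (entryR P d e K k col) ≤ (Z + 2) ^ d * c * Z ^ d / τ ^ k := by
  have hϱ0 : 0 ≤ ϱ := zero_le_one.trans hϱ1
  have hc0 : 0 ≤ c := zero_le_one.trans hc1
  have hZ0 : 0 ≤ Z := zero_le_one.trans hZ1
  have hτk : 0 < τ ^ k := pow_pos hτ0 k
  have hE0 : 0 ≤ (Z + 2) ^ d * c * Z ^ d := by positivity
  -- generic comparison tools
  have hZpow : ∀ {a b : ℕ}, a ≤ b → Z ^ a ≤ Z ^ b := fun h => pow_le_pow_right₀ hZ1 h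
  have hZ2pow : ∀ {a b : ℕ}, a ≤ b → (Z + 2) ^ a ≤ (Z + 2) ^ b := fun h => pow_le_pow_right₀ (by linarith) h
  rw [entryR]
  split_ifs with hlt heq
  · -- `l < k`
    obtain ⟨-, hπ⟩ := powA_polyNorm_le P d e q hq hτ hΦ0 hϱ0 hc0 hZ0 hM hΦ hϱ hZ hρτc hsmall K col.1
    have hcoeff : q ((powA P d e K col.1).coeff (k - col.2.1)) ≤ (Z + 2) ^ col.1 * c / τ ^ (k - col.2.1 - 1) := by
      have h := seminorm_coeff_le_div q hτ0 (divX (powA P d e K col.1)) (k - col.2.1 - 1)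
      rw [coeff_divX, show k - col.2.1 - 1 + 1 = k - col.2.1 by omega] at h
      exact h.trans (div_le_div_of_nonneg_right hπ (pow_pos hτ0 _).le)
    have hρl : q (rhoR P d ^ (2 * col.2.1)) ≤ ϱ ^ (2 * col.2.1) := seminorm_pow_le_of_le q hq hϱ _
    have hzι : q (zbar P ^ col.2.2) ≤ Z ^ col.2.2 := seminorm_pow_le_of_le q hq hZ _
    have hprod : q (rhoR P d ^ (2 * col.2.1) * (powA P d e K col.1).coeff (k - col.2.1) * zbar P ^ col.2.2) ≤
        ϱ ^ (2 * col.2.1) * ((Z + 2) ^ col.1 * c / τ ^ (k - col.2.1 - 1)) * Z ^ col.2.2 := by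
      refine (map_mul_le_mul q _ _).trans (mul_le_mul ((map_mul_le_mul q _ _).trans
        (mul_le_mul hρl hcoeff (apply_nonneg q _) (pow_nonneg hϱ0 _))) hzι (apply_nonneg q _) ?_)
      exact mul_nonneg (pow_nonneg hϱ0 _) (div_nonneg (mul_nonneg (pow_nonneg (by linarith) _) hc0) (pow_pos hτ0 _).le)
    refine hprod.trans ?_
    -- compare with `E / τ^k`
    rw [div_eq_mul_inv, div_eq_mul_inv]
    obtain ⟨t, rfl⟩ : ∃ t, k = col.2.1 + 1 + t := ⟨k - col.2.1 - 1, by omega⟩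
    rw [show col.2.1 + 1 + t - col.2.1 - 1 = t by omega]
    have hτinv : (τ ^ (col.2.1 + 1 + t))⁻¹ = (τ ^ col.2.1)⁻¹ * τ⁻¹ * (τ ^ t)⁻¹ := by
      rw [pow_add, pow_add, pow_one, mul_inv, mul_inv]
    rw [hτinv]
    have hρτl : ϱ ^ (2 * col.2.1) * (τ ^ col.2.1) ≤ 1 := by
      rw [pow_mul, ← mul_pow]; exact pow_le_one₀ (by positivity) hρτ
    have hτl : 0 < τ ^ col.2.1 := pow_pos hτ0 _
    have hA : ϱ ^ (2 * col.2.1) ≤ (τ ^ col.2.1)⁻¹ := by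
      rw [le_inv_comm₀ (by positivity) hτl]
      calc τ ^ col.2.1 = (ϱ ^ (2 * col.2.1))⁻¹ * (ϱ ^ (2 * col.2.1) * τ ^ col.2.1) := by
            rw [← mul_assoc, inv_mul_cancel₀ (by positivity), one_mul]
        _ ≤ (ϱ ^ (2 * col.2.1))⁻¹ * 1 := mul_le_mul_of_nonneg_left hρτl (by positivity)
        _ = (ϱ ^ (2 * col.2.1))⁻¹ := mul_one _
    have hB : (1 : ℝ) ≤ τ⁻¹ := one_le_inv_iff₀.2 ⟨hτ0, hτ1⟩
    have hC : (Z + 2) ^ col.1 * c * Z ^ col.2.2 ≤ (Z + 2) ^ d * c * Z ^ d :=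
      mul_le_mul (mul_le_mul_of_nonneg_right (hZ2pow hcol1.le) hc0) (hZpow hcol3.le) (pow_nonneg hZ0 _) (by positivity)
    have ht0 : 0 ≤ (τ ^ t)⁻¹ := by positivity
    calc ϱ ^ (2 * col.2.1) * ((Z + 2) ^ col.1 * c * (τ ^ t)⁻¹) * Z ^ col.2.2
        = ϱ ^ (2 * col.2.1) * 1 * (((Z + 2) ^ col.1 * c * Z ^ col.2.2) * (τ ^ t)⁻¹) := by ring
      _ ≤ (τ ^ col.2.1)⁻¹ * τ⁻¹ * (((Z + 2) ^ d * c * Z ^ d) * (τ ^ t)⁻¹) := by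
          refine mul_le_mul (mul_le_mul hA hB zero_le_one (by positivity))
            (mul_le_mul_of_nonneg_right hC ht0) (by positivity) (by positivity)
      _ = (Z + 2) ^ d * c * Z ^ d * ((τ ^ col.2.1)⁻¹ * τ⁻¹ * (τ ^ t)⁻¹) := by ring
  · -- `l = k`
    subst heq
    by_cases h0 : col.2.1 = 0
    · rw [h0, show 2 * 0 - 1 = 0 from rfl, pow_zero, one_mul, pow_zero, div_one]
      refine (seminorm_pow_le_of_le q hq hZ _).trans ?_
      calc Z ^ (col.1 + col.2.2) ≤ Z ^ d * Z ^ d := by rw [← pow_add]; exact hZpow (by omega)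
        _ ≤ (Z + 2) ^ d * c * Z ^ d := by
            refine mul_le_mul_of_nonneg_right ?_ (pow_nonneg hZ0 _)
            calc Z ^ d = Z ^ d * 1 := (mul_one _).symm
              _ ≤ (Z + 2) ^ d * c := mul_le_mul (pow_le_pow_left₀ hZ0 (by linarith) d) hc1 zero_le_one (by positivity)
    · refine (map_mul_le_mul q _ _).trans ?_
      refine (mul_le_mul (seminorm_pow_le_of_le q hq hϱ _) (seminorm_pow_le_of_le q hq hZ _)
        (apply_nonneg q _) (pow_nonneg hϱ0 _)).trans ?_
      rw [le_div_iff₀ hτk]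
      have hρ2 : ϱ ^ (2 * col.2.1 - 1) * τ ^ col.2.1 ≤ 1 := by
        calc ϱ ^ (2 * col.2.1 - 1) * τ ^ col.2.1 ≤ ϱ ^ (2 * col.2.1) * τ ^ col.2.1 :=
              mul_le_mul_of_nonneg_right (pow_le_pow_right₀ hϱ1 (by omega)) (pow_nonneg hτ _)
          _ = (ϱ ^ 2 * τ) ^ col.2.1 := by rw [pow_mul, mul_pow]
          _ ≤ 1 := pow_le_one₀ (by positivity) hρτ
      have hZsum : Z ^ (col.1 + col.2.2) ≤ (Z + 2) ^ d * c * Z ^ d := by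
        calc Z ^ (col.1 + col.2.2) ≤ Z ^ d * Z ^ d := by rw [← pow_add]; exact hZpow (by omega)
          _ ≤ (Z + 2) ^ d * c * Z ^ d := by
              refine mul_le_mul_of_nonneg_right ?_ (pow_nonneg hZ0 _)
              calc Z ^ d = Z ^ d * 1 := (mul_one _).symm
                _ ≤ (Z + 2) ^ d * c := mul_le_mul (pow_le_pow_left₀ hZ0 (by linarith) d) hc1 zero_le_one (by positivity)
      calc ϱ ^ (2 * col.2.1 - 1) * Z ^ (col.1 + col.2.2) * τ ^ col.2.1
          = (ϱ ^ (2 * col.2.1 - 1) * τ ^ col.2.1) * Z ^ (col.1 + col.2.2) := by ring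
        _ ≤ 1 * ((Z + 2) ^ d * c * Z ^ d) := mul_le_mul hρ2 hZsum (pow_nonneg hZ0 _) zero_le_one
        _ = (Z + 2) ^ d * c * Z ^ d := one_mul _
  · rw [map_zero]; positivity

end Newton

end Literature.RingTheory.MvPolynomial.KaltofenBounds

end

/-!
# Part V — the norm of the forms `Δ` (Thm. 4, norms)

Support file for the proof of Kaltofen's Theorem 7 (`kaltofen1995_thm7`; E. Kaltofen, *Effective
Noether irreducibility forms and applications*, J. Comput. System Sci. 50 (1995) 274–295, §3
Thms. 1–4): the maximal minors `genMinor d S` (`KaltofenTestDefs`) of the matrix (29) of the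
generic polynomial satisfy Kaltofen's height bound

  `‖genMinor d S‖₁ ≤ (2d)^{34 d⁶}`   (`l1Norm_genMinor_le`).

We instantiate the majorant bookkeeping of Part IV of this file with the weighted `ℓ¹`
seminorm `normRt d` of `KaltofenBoundsNormTools` (`z` of weight `2`) on
`R = ℤ[c][z]/(f₀)`, Kaltofen's explicit constants `rhoNn` (`‖ρ‖`), `cofNn` (`‖r‖`), `taylNn`
(`‖F_{j,i}‖`), the majorant level `cNn = 2‖r‖‖F‖` and the weight `τ = 1/gNn`,
`gNn = 2(d+1)(e+1)·cNn²`; every quantity is `(2d)^{O(d)}`, the entries of row `k` of (29) are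
`≤ ENn · gNnᵏ`, and with the layer-cake estimate `2Σk ≤ d²(d+1)(3d²−3d+1)` the minors are
`≤ N!·ENn^N·gNn^{Σk} ≤ (2d)^{(8d+2)N + (12d+1)Σk} ≤ (2d)^{34d⁶}`.

The definitions of this file are the explicit numerical constants only; no named facts.

## References

* E. Kaltofen, J. Comput. System Sci. 50 (1995) 274–295, §3 Thms. 1–4. [Kaltofen1995]
-/

noncomputable section

open Polynomial

namespace Literature.RingTheory.MvPolynomial.KaltofenBounds

open Literature.RingTheory.MvPolynomial.KaltofenAIT
open Literature.RingTheory.MvPolynomial.NoetherForms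

/-! ### Kaltofen's constants -/

section Consts

variable (d : ℕ)

/-- `‖ρ‖ ≤ rhoNn d = (2d−1)! · d^{2d−1}`. [cite: Kaltofen1995, §3 Thm. 1 (13)] -/
def rhoNn : ℕ := (d + (d - 1)).factorial * d ^ (d + (d - 1))

/-- `‖r‖₂ ≤ cofNn d = d · (2d−1)! d^{2d−2} · 2^{d−1}` (weighted norm of the cofactor). [cite: Kaltofen1995, §3 (13)] -/
def cofNn : ℕ := d * ((d + (d - 1)).factorial * d ^ (d + (d - 1) - 1)) * 2 ^ (d - 1)

/-- `‖F_{j,i}‖₂ ≤ taylNn d = (d+1) · 2^{2d} · 2^d` for `i ≤ d`. [cite: Kaltofen1995, §3 Thm. 2] -/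
def taylNn : ℕ := (d + 1) * (2 ^ (2 * d) * 2 ^ d)

/-- The majorant level `cNn d = 2 ‖r‖ ‖F‖` of the Newton iteration. [cite: Kaltofen1995, §3 Thm. 1] -/
def cNn : ℕ := 2 * cofNn d * taylNn d

/-- The inverse weight `gNn d e = 2(d+1)(e+1) · cNn²` (`τ = 1/gNn`): the growth rate per power of
`Y` of Kaltofen's numerators. [cite: Kaltofen1995, §3 Thm. 1] -/
def gNn (e : ℕ) : ℕ := 2 * ((d + 1) * (e + 1)) * cNn d ^ 2

/-- The entry constant `ENn d = 4^d · cNn · 2^d` of the matrix (29). [cite: Kaltofen1995, §3 Thm. 4] -/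
def ENn : ℕ := 4 ^ d * cNn d * 2 ^ d

/-- `cNn = rhoNn · (d+1) · 16^d` (`d ≥ 1`). [folklore] -/
theorem cNn_eq (hd : 1 ≤ d) : cNn d = rhoNn d * ((d + 1) * 2 ^ (4 * d)) := by
  obtain ⟨d', rfl⟩ : ∃ d', d = d' + 1 := ⟨d - 1, by omega⟩
  simp only [cNn, cofNn, taylNn, rhoNn, Nat.add_sub_cancel, show d' + 1 + d' = d' + d' + 1 by ring,
    pow_succ, show 2 * (d' + 1) = d' + d' + 1 + 1 by ring, show 4 * (d' + 1) = d' + d' + d' + d' + 1 + 1 + 1 + 1 by ring,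
    pow_add]
  ring

/-- `1 ≤ rhoNn d` (`d ≥ 1`). [folklore] -/
theorem one_le_rhoNn (hd : 1 ≤ d) : 1 ≤ rhoNn d :=
  Nat.mul_pos (Nat.factorial_pos _) (Nat.pow_pos hd)

/-- `rhoNn ≤ cNn` (`d ≥ 1`). [folklore] -/
theorem rhoNn_le_cNn (hd : 1 ≤ d) : rhoNn d ≤ cNn d := by
  rw [cNn_eq d hd]
  exact Nat.le_mul_of_pos_right _ (Nat.mul_pos (by omega) (Nat.pow_pos (by norm_num)))

/-- `1 ≤ cNn d` (`d ≥ 1`). [folklore] -/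
theorem one_le_cNn (hd : 1 ≤ d) : 1 ≤ cNn d := (one_le_rhoNn d hd).trans (rhoNn_le_cNn d hd)

/-- `1 ≤ gNn d e` (`d ≥ 1`). [folklore] -/
theorem one_le_gNn (hd : 1 ≤ d) (e : ℕ) : 1 ≤ gNn d e :=
  Nat.mul_pos (Nat.mul_pos (by norm_num) (Nat.mul_pos (by omega) (by omega))) (Nat.pow_pos (one_le_cNn d hd))

end Consts

/-! ### The weighted `ℓ¹` seminorm on `R = ℤ[c][z]/(f₀)` and the basic bounds -/

section NormRt

variable (d : ℕ)

/-- The weighted `ℓ¹` seminorm (`z` of weight `2`) on `R = ℤ[c][z]/(f₀)` for the generic polynomial.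
[folklore] -/
def normRt : RingSeminorm (Rt (genPoly d)) :=
  rSeminorm (l1Seminorm (ℕ × ℕ)) (t := 2) (by norm_num) (red_genPoly_monic d) (polyNorm_red_genPoly_tail_le d)

/-- Unfolding `normRt`. [folklore] -/
theorem normRt_apply (a : Rt (genPoly d)) :
    normRt d a = rnorm (l1Seminorm (ℕ × ℕ)) 2 (red_genPoly_monic d) a := rfl

/-- `normRt 1 ≤ 1`. [folklore] -/
theorem normRt_one_le : normRt d 1 ≤ 1 := by
  rw [normRt_apply]
  exact (rnorm_one_le _ _ (by norm_num) (polyNorm_red_genPoly_tail_le d)).trans (by rw [l1Seminorm_one])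

/-- `‖r‖ ≤ cofNn`. [cite: Kaltofen1995, §3 (13)] -/
theorem normRt_cof_le (hd : d ≠ 0) : normRt d (cof (genPoly d) d) ≤ cofNn d := by
  rw [normRt_apply, cofNn]; push_cast; exact rnorm_cof_le d hd

/-- `‖F_{j,i}‖ ≤ taylNn` for `i ≤ d`. [cite: Kaltofen1995, §3 Thm. 2] -/
theorem normRt_tayl_le (i : ℕ) (hi : i ∈ Finset.range (d + 1)) (j : ℕ) :
    normRt d ((tayl (genPoly d) i).coeff j) ≤ taylNn d := by
  rw [normRt_apply, taylNn]
  refine (rnorm_coeff_tayl_le d i j).trans ?_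
  push_cast
  have hi' := Finset.mem_range.1 hi
  gcongr
  · norm_num
  · omega

/-- `‖ρ‖ ≤ rhoNn`. [cite: Kaltofen1995, §3 Thm. 1 (13)] -/
theorem normRt_rho_le (hd : d ≠ 0) : normRt d (rhoR (genPoly d) d) ≤ rhoNn d := by
  rw [normRt_apply, rhoNn, rhoR]
  refine (rnorm_algebraMap_le _ _ (by norm_num) (polyNorm_red_genPoly_tail_le d) _).trans ?_
  rw [l1Seminorm_apply]; push_cast; exact l1Norm_rres_le d hd

/-- `‖z̄‖ ≤ 2`. [folklore] -/
theorem normRt_zbar_le : normRt d (zbar (genPoly d)) ≤ 2 := by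
  rw [normRt_apply, zbar]
  refine (rnorm_root_le _ _ (by norm_num) (polyNorm_red_genPoly_tail_le d)).trans ?_
  rw [l1Seminorm_one, one_mul]

/-- The entries of `kMatrix` are dominated by `normRt` of the entries `entryR`. [folklore] -/
theorem l1Norm_kMatrix_le_normRt (e K ℓ : ℕ) (r : Fin (ℓ + 1) × Fin d) (c : Fin d × Fin (e + 1) × Fin d) :
    (l1Norm (kMatrix (genPoly d) d e K (red_genPoly_monic d) ℓ r c) : ℝ) ≤
      normRt d (entryR (genPoly d) d e K r.1 ((c.1 : ℕ), (c.2.1 : ℕ), (c.2.2 : ℕ))) := by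
  rw [kMatrix, normRt_apply, ← l1Seminorm_apply]
  exact coeff_le_rnorm _ _ (by norm_num) _ _

end NormRt

/-! ### The smallness of the weight -/

section Small

variable (d e : ℕ)

/-- Each term of the smallness sum is at most `Φ·[i=0][j=1] + Φ/(2(d+1)(e+1))`. [folklore] -/
theorem small_term_le (hd : 1 ≤ d) (i j : ℕ) :
    (if (i = 0 ∧ j = 0) ∨ (i = 1 ∧ j = 0) then (0 : ℝ)
      else ((gNn d e : ℝ))⁻¹ ^ (i + j - 1) * ((taylNn d : ℝ) * (rhoNn d : ℝ) ^ (i + 2 * j - 2)) * (cNn d : ℝ) ^ i) ≤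
      (if i = 0 then (1 : ℝ) else 0) * (if j = 1 then (taylNn d : ℝ) else 0) +
        (taylNn d : ℝ) / (2 * ((d + 1 : ℕ) * (e + 1 : ℕ) : ℝ)) := by
  have hΦ0 : (0 : ℝ) ≤ taylNn d := Nat.cast_nonneg _
  have hden : (0 : ℝ) < 2 * ((d + 1 : ℕ) * (e + 1 : ℕ) : ℝ) := by positivity
  have hc1 : (1 : ℝ) ≤ cNn d := by exact_mod_cast one_le_cNn d hd
  have hρc : (rhoNn d : ℝ) ≤ cNn d := by exact_mod_cast rhoNn_le_cNn d hd
  have hρ0 : (0 : ℝ) ≤ rhoNn d := Nat.cast_nonneg _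
  have hg : (gNn d e : ℝ) = 2 * ((d + 1 : ℕ) * (e + 1 : ℕ) : ℝ) * (cNn d : ℝ) ^ 2 := by
    rw [gNn]; push_cast; ring
  have hind : 0 ≤ (if i = 0 then (1 : ℝ) else 0) * (if j = 1 then (taylNn d : ℝ) else 0) := by
    split_ifs <;> simp [hΦ0]
  by_cases hij : (i = 0 ∧ j = 0) ∨ (i = 1 ∧ j = 0)
  · rw [if_pos hij]; exact add_nonneg hind (div_nonneg hΦ0 hden.le)
  rw [if_neg hij]
  by_cases h01 : i = 0 ∧ j = 1
  · obtain ⟨rfl, rfl⟩ := h01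
    rw [if_pos rfl, if_pos rfl, one_mul]
    norm_num
    positivity
  · -- `i + j ≥ 2`
      obtain ⟨s, hs⟩ : ∃ s, i + j = s + 2 := ⟨i + j - 2, by omega⟩
      have hu : i + 2 * j - 2 + i = 2 * (s + 1) := by omega
      refine le_add_of_nonneg_of_le hind ?_
      rw [show i + j - 1 = s + 1 by omega]
      have hτc : ((gNn d e : ℝ))⁻¹ * (cNn d : ℝ) ^ 2 = 1 / (2 * ((d + 1 : ℕ) * (e + 1 : ℕ) : ℝ)) := by
        rw [hg, one_div, mul_inv, inv_mul_cancel_right₀ (by positivity)]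
      have hτc1 : ((gNn d e : ℝ))⁻¹ * (cNn d : ℝ) ^ 2 ≤ 1 := by
        rw [hτc, div_le_one hden]
        have h1 : 1 ≤ (d + 1) * (e + 1) := Nat.one_le_iff_ne_zero.2 (by positivity)
        have : (1 : ℝ) ≤ ((d + 1 : ℕ) * (e + 1 : ℕ) : ℝ) := by exact_mod_cast h1
        linarith
      have hτ0 : (0 : ℝ) ≤ ((gNn d e : ℝ))⁻¹ := by positivity
      calc ((gNn d e : ℝ))⁻¹ ^ (s + 1) * ((taylNn d : ℝ) * (rhoNn d : ℝ) ^ (i + 2 * j - 2)) * (cNn d : ℝ) ^ i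
          ≤ ((gNn d e : ℝ))⁻¹ ^ (s + 1) * ((taylNn d : ℝ) * (cNn d : ℝ) ^ (i + 2 * j - 2)) * (cNn d : ℝ) ^ i := by
            gcongr
        _ = (taylNn d : ℝ) * (((gNn d e : ℝ))⁻¹ * (cNn d : ℝ) ^ 2) ^ (s + 1) := by
            rw [mul_pow, ← pow_mul, mul_assoc, mul_assoc, ← pow_add, hu]; ring
        _ ≤ (taylNn d : ℝ) * (((gNn d e : ℝ))⁻¹ * (cNn d : ℝ) ^ 2) ^ 1 := by
            refine mul_le_mul_of_nonneg_left (pow_le_pow_of_le_one (by positivity) hτc1 (by omega)) hΦ0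
        _ = (taylNn d : ℝ) / (2 * ((d + 1 : ℕ) * (e + 1 : ℕ) : ℝ)) := by rw [pow_one, hτc, mul_one_div]

/-- **The weight is small enough** (the hypothesis `hsmall` of Part IV of this file):
`‖r‖ · Σ_{(i,j)≠(0,0),(1,0)} τ^{i+j−1} ‖F‖ ‖ρ‖^{i+2j−2} cⁱ ≤ c` for `τ = 1/gNn`, `c = cNn`.
[cite: Kaltofen1995, §3 Thm. 1] -/
theorem small (hd : 1 ≤ d) :
    (cofNn d : ℝ) * (∑ i ∈ Finset.range (d + 1), ∑ j ∈ Finset.range (e + 1),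
      if (i = 0 ∧ j = 0) ∨ (i = 1 ∧ j = 0) then (0 : ℝ)
      else ((gNn d e : ℝ))⁻¹ ^ (i + j - 1) * ((taylNn d : ℝ) * (rhoNn d : ℝ) ^ (i + 2 * j - 2)) * (cNn d : ℝ) ^ i) ≤
      cNn d := by
  have hΦ0 : (0 : ℝ) ≤ taylNn d := Nat.cast_nonneg _
  have hM0 : (0 : ℝ) ≤ cofNn d := Nat.cast_nonneg _
  have hsum := Finset.sum_le_sum fun i (hi : i ∈ Finset.range (d + 1)) =>
    Finset.sum_le_sum fun j (hj : j ∈ Finset.range (e + 1)) => small_term_le d e hd i j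
  refine (mul_le_mul_of_nonneg_left hsum hM0).trans ?_
  have hind : ∑ i ∈ Finset.range (d + 1), ∑ j ∈ Finset.range (e + 1),
      (if i = 0 then (1 : ℝ) else 0) * (if j = 1 then (taylNn d : ℝ) else 0) ≤ taylNn d := by
    rw [← Finset.sum_mul_sum, Finset.sum_ite_eq' (Finset.range (d + 1)) 0 (fun _ => (1 : ℝ)),
      if_pos (Finset.mem_range.2 (by omega)), one_mul, Finset.sum_ite_eq' (Finset.range (e + 1)) 1]
    split_ifs
    · exact le_rfl
    · exact hΦ0
  have hconst : ∑ i ∈ Finset.range (d + 1), ∑ j ∈ Finset.range (e + 1),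
      (taylNn d : ℝ) / (2 * ((d + 1 : ℕ) * (e + 1 : ℕ) : ℝ)) = (taylNn d : ℝ) / 2 := by
    rw [Finset.sum_const, Finset.sum_const, Finset.card_range, Finset.card_range, nsmul_eq_mul, nsmul_eq_mul]
    push_cast
    field_simp
  rw [Finset.sum_congr rfl fun i _ => Finset.sum_add_distrib, Finset.sum_add_distrib, hconst]
  rw [cNn]; push_cast
  nlinarith

end Small

/-! ### The entries and the minors -/

section Minor

variable (d : ℕ)

/-- The entries of row `(k, j)` of Kaltofen's matrix (29) have `‖·‖₁ ≤ ENn · gNnᵏ`.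
[cite: Kaltofen1995, §3 Thm. 4] -/
theorem l1Norm_kMatrix_le (hd : 2 ≤ d) (e K ℓ : ℕ) (r : Fin (ℓ + 1) × Fin d) (c : Fin d × Fin (e + 1) × Fin d) :
    (l1Norm (kMatrix (genPoly d) d e K (red_genPoly_monic d) ℓ r c) : ℝ) ≤ (ENn d : ℝ) * (gNn d e : ℝ) ^ (r.1 : ℕ) := by
  have hd1 : 1 ≤ d := by omega
  have hg1 : (1 : ℝ) ≤ gNn d e := by exact_mod_cast one_le_gNn d hd1 e
  have hg0 : (0 : ℝ) < gNn d e := by positivity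
  set τ : ℝ := ((gNn d e : ℝ))⁻¹ with hτ
  have hτ0 : 0 < τ := by positivity
  have hτ1 : τ ≤ 1 := inv_le_one_of_one_le₀ hg1
  have hc1 : (1 : ℝ) ≤ cNn d := by exact_mod_cast one_le_cNn d hd1
  have hρ1 : (1 : ℝ) ≤ rhoNn d := by exact_mod_cast one_le_rhoNn d hd1
  have hρc : (rhoNn d : ℝ) ≤ cNn d := by exact_mod_cast rhoNn_le_cNn d hd1
  have hg : (gNn d e : ℝ) = 2 * ((d + 1 : ℕ) * (e + 1 : ℕ) : ℝ) * (cNn d : ℝ) ^ 2 := by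
    rw [gNn]; push_cast; ring
  have hc2g : (cNn d : ℝ) ^ 2 ≤ gNn d e := by
    rw [hg]
    have : (1 : ℝ) ≤ 2 * ((d + 1 : ℕ) * (e + 1 : ℕ) : ℝ) := by
      have h1 : 1 ≤ (d + 1) * (e + 1) := Nat.one_le_iff_ne_zero.2 (by positivity)
      have : (1 : ℝ) ≤ ((d + 1 : ℕ) * (e + 1 : ℕ) : ℝ) := by exact_mod_cast h1
      linarith
    nlinarith
  have hρτ : (rhoNn d : ℝ) ^ 2 * τ ≤ 1 := by
    rw [hτ, ← div_eq_mul_inv, div_le_one hg0]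
    exact (pow_le_pow_left₀ (by positivity) hρc 2).trans hc2g
  have hρτc : (rhoNn d : ℝ) * τ * (cNn d : ℝ) ≤ 1 := by
    rw [hτ, mul_right_comm, ← div_eq_mul_inv, div_le_one hg0]
    calc (rhoNn d : ℝ) * cNn d ≤ cNn d * cNn d := mul_le_mul_of_nonneg_right hρc (by positivity)
      _ = (cNn d : ℝ) ^ 2 := (sq _).symm
      _ ≤ gNn d e := hc2g
  have h := seminorm_entryR_le (genPoly d) d e (normRt d) (normRt_one_le d) hτ0.le
    (M := cofNn d) (Φ := taylNn d) (ϱ := rhoNn d) (c := cNn d) (Z := 2)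
    hτ0 hτ1 (Nat.cast_nonneg _) hρ1 hc1 (by norm_num) (normRt_cof_le d (by omega))
    (fun i hi j _ => normRt_tayl_le d i hi j) (normRt_rho_le d (by omega)) (normRt_zbar_le d) hρτ hρτc
    (small d e hd1) K r.1 ((c.1 : ℕ), (c.2.1 : ℕ), (c.2.2 : ℕ)) c.1.is_lt c.2.2.is_lt
  refine (l1Norm_kMatrix_le_normRt d e K ℓ r c).trans (h.trans (le_of_eq ?_))
  rw [hτ, inv_pow, div_inv_eq_mul, ENn]
  push_cast
  ring

/-- The product of the row bounds of an injective choice of `N` rows: `∏ ENn·g^{k} = ENn^N g^{Σk}`.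
[folklore] -/
theorem prod_rowBound_eq {e ℓ : ℕ} {C : Type*} [Fintype C] (S : C → Fin (ℓ + 1) × Fin d) :
    ∏ c, (ENn d : ℝ) * (gNn d e : ℝ) ^ ((S c).1 : ℕ) =
      (ENn d : ℝ) ^ Fintype.card C * (gNn d e : ℝ) ^ (∑ c, ((S c).1 : ℕ)) := by
  rw [Finset.prod_mul_distrib, Finset.prod_const, Finset.card_univ, Finset.prod_pow_eq_pow_sum]

/-! ### Powers of `2d` -/

/-- `rhoNn ≤ (2d)^{4d−2}`. [folklore] -/
theorem rhoNn_le_pow (hd : 1 ≤ d) : rhoNn d ≤ (2 * d) ^ (4 * d - 2) := by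
  have h1 : (d + (d - 1)).factorial ≤ (2 * d) ^ (d + (d - 1)) :=
    (Nat.factorial_le_pow _).trans (Nat.pow_le_pow_left (by omega) _)
  have h2 : d ^ (d + (d - 1)) ≤ (2 * d) ^ (d + (d - 1)) := Nat.pow_le_pow_left (by omega) _
  calc rhoNn d = (d + (d - 1)).factorial * d ^ (d + (d - 1)) := rfl
    _ ≤ (2 * d) ^ (d + (d - 1)) * (2 * d) ^ (d + (d - 1)) := Nat.mul_le_mul h1 h2
    _ = (2 * d) ^ (4 * d - 2) := by rw [← pow_add]; congr 1; omega

/-- `cNn ≤ (2d)^{6d−1}` (`d ≥ 2`). [folklore] -/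
theorem cNn_le_pow (hd : 2 ≤ d) : cNn d ≤ (2 * d) ^ (6 * d - 1) := by
  rw [cNn_eq d (by omega), show 6 * d - 1 = (4 * d - 2) + (1 + 2 * d) by omega, pow_add, pow_add, pow_one]
  refine Nat.mul_le_mul (rhoNn_le_pow d (by omega)) (Nat.mul_le_mul (by omega) ?_)
  have h16 : 16 ≤ (2 * d) ^ 2 := by nlinarith
  calc 2 ^ (4 * d) = 16 ^ d := by rw [pow_mul]; norm_num
    _ ≤ ((2 * d) ^ 2) ^ d := Nat.pow_le_pow_left h16 d
    _ = (2 * d) ^ (2 * d) := by rw [← pow_mul]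

/-- `gNn d d ≤ (2d)^{12d+1}` (`d ≥ 2`). [folklore] -/
theorem gNn_le_pow (hd : 2 ≤ d) : gNn d d ≤ (2 * d) ^ (12 * d + 1) := by
  rw [gNn, show 12 * d + 1 = 3 + ((6 * d - 1) + (6 * d - 1)) by omega, pow_add, pow_add, sq]
  refine Nat.mul_le_mul ?_ (Nat.mul_le_mul (cNn_le_pow d hd) (cNn_le_pow d hd))
  calc 2 * ((d + 1) * (d + 1)) ≤ 2 * d * (2 * d) * (2 * d) := by nlinarith
    _ = (2 * d) ^ 3 := by ring

/-- `ENn ≤ (2d)^{8d−1}` (`d ≥ 2`). [folklore] -/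
theorem ENn_le_pow (hd : 2 ≤ d) : ENn d ≤ (2 * d) ^ (8 * d - 1) := by
  rw [ENn, mul_right_comm, ← mul_pow, show (4 * 2 : ℕ) = 8 by norm_num,
    show 8 * d - 1 = 2 * d + (6 * d - 1) by omega, pow_add]
  refine Nat.mul_le_mul ?_ (cNn_le_pow d hd)
  rw [pow_mul]
  exact Nat.pow_le_pow_left (by nlinarith) _

/-- `N! ≤ (2d)^{3N}` for `N = d·((d+1)·d)`. [folklore] -/
theorem factorial_col_le_pow (hd : 1 ≤ d) : (d * ((d + 1) * d)).factorial ≤ (2 * d) ^ (3 * (d * ((d + 1) * d))) := by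
  refine (Nat.factorial_le_pow _).trans ?_
  rw [show (2 * d) ^ (3 * (d * ((d + 1) * d))) = ((2 * d) ^ 3) ^ (d * ((d + 1) * d)) from pow_mul _ _ _]
  refine Nat.pow_le_pow_left ?_ _
  calc d * ((d + 1) * d) ≤ 2 * d * (2 * d) * (2 * d) := by nlinarith
    _ = (2 * d) ^ 3 := by ring

/-- The exponent budget: `2·((8d+2)N + (12d+1)Σk) ≤ 68 d⁶` from the layer-cake bound. [folklore] -/
theorem norm_budget (s : ℕ) (hd : 2 ≤ d)
    (hs : 2 * s ≤ d * ((d + 1) * d) * (2 * ((2 * d - 1) * d) + 1 - (d + 1) * d)) :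
    3 * (d * ((d + 1) * d)) + (8 * d - 1) * (d * ((d + 1) * d)) + (12 * d + 1) * s ≤ 34 * d ^ 6 := by
  obtain ⟨d', rfl⟩ : ∃ d', d = d' + 2 := ⟨d - 2, by omega⟩
  rw [layerCake_eq] at hs
  rw [show 8 * (d' + 2) - 1 = 8 * d' + 15 by omega]
  have h1 : (12 * (d' + 2) + 1) * (2 * s) ≤ (12 * (d' + 2) + 1) * ((d' + 2) ^ 2 * (d' + 3) * (3 * d' ^ 2 + 9 * d' + 7)) :=
    Nat.mul_le_mul_left _ hs
  nlinarith [h1, Nat.zero_le (d' ^ 2), Nat.zero_le (d' ^ 3), Nat.zero_le (d' ^ 4), Nat.zero_le (d' ^ 5),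
    Nat.zero_le (d' ^ 6), Nat.zero_le d']

/-- **Kaltofen's Thm. 4 (height of the forms):** every maximal minor `Δ_S` of the matrix (29) of the
generic polynomial of degree `d ≥ 2` has `‖Δ_S‖₁ ≤ (2d)^{34 d⁶}`. [cite: Kaltofen1995, §3 Thm. 4] -/
theorem l1Norm_genMinor_le (hd : 2 ≤ d)
    (S : Fin d × Fin (d + 1) × Fin d → Fin ((2 * d - 1) * d + 1) × Fin d) :
    l1Norm (genMinor d S) ≤ (2 * d) ^ (34 * d ^ 6) := by
  classical
  by_cases hS : Function.Injective S
  · have hreal : (l1Norm (genMinor d S) : ℝ) ≤ ((2 * d : ℕ) : ℝ) ^ (34 * d ^ 6) := by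
      rw [genMinor, ← l1Seminorm_apply]
      have hE0 : (0 : ℝ) ≤ ENn d := Nat.cast_nonneg _
      have hg1 : (1 : ℝ) ≤ gNn d d := by exact_mod_cast one_le_gNn d (by omega) d
      refine (seminorm_det_le_rows (l1Seminorm (ℕ × ℕ)) (by rw [l1Seminorm_one]) _
        (fun c => (ENn d : ℝ) * (gNn d d : ℝ) ^ ((S c).1 : ℕ)) (fun c => by positivity) (fun c c' => ?_)).trans ?_
      · rw [Matrix.submatrix_apply, id]
        exact l1Norm_kMatrix_le d hd d _ _ (S c) c'
      · rw [prod_rowBound_eq, card_col]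
        have hsum2 := two_mul_sum_fst_le S hS (card_col d) (Nat.mul_le_mul_right d (by omega))
        have hnat : (d * ((d + 1) * d)).factorial * (ENn d ^ (d * ((d + 1) * d)) * gNn d d ^ (∑ c, ((S c).1 : ℕ)))
            ≤ (2 * d) ^ (34 * d ^ 6) :=
          calc (d * ((d + 1) * d)).factorial * (ENn d ^ (d * ((d + 1) * d)) * gNn d d ^ (∑ c, ((S c).1 : ℕ)))
              ≤ (2 * d) ^ (3 * (d * ((d + 1) * d))) *
                  (((2 * d) ^ (8 * d - 1)) ^ (d * ((d + 1) * d)) * ((2 * d) ^ (12 * d + 1)) ^ (∑ c, ((S c).1 : ℕ))) :=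
                Nat.mul_le_mul (factorial_col_le_pow d (by omega))
                  (Nat.mul_le_mul (Nat.pow_le_pow_left (ENn_le_pow d hd) _) (Nat.pow_le_pow_left (gNn_le_pow d hd) _))
            _ = (2 * d) ^ (3 * (d * ((d + 1) * d)) + (8 * d - 1) * (d * ((d + 1) * d)) +
                  (12 * d + 1) * (∑ c, ((S c).1 : ℕ))) := by
                rw [← pow_mul, ← pow_mul, ← pow_add, ← pow_add, add_assoc]
            _ ≤ (2 * d) ^ (34 * d ^ 6) := Nat.pow_le_pow_right (by omega) (norm_budget d _ hd hsum2)
        have hcast : ((d * ((d + 1) * d)).factorial : ℝ) * ((ENn d : ℝ) ^ (d * ((d + 1) * d)) *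
            (gNn d d : ℝ) ^ (∑ c, ((S c).1 : ℕ))) =
            (((d * ((d + 1) * d)).factorial * (ENn d ^ (d * ((d + 1) * d)) * gNn d d ^ (∑ c, ((S c).1 : ℕ))) : ℕ) : ℝ) := by
          push_cast; ring
        rw [hcast]
        exact_mod_cast hnat
    exact_mod_cast hreal
  · obtain ⟨c, c', hcc', hne⟩ := Function.not_injective_iff.1 hS
    have h0 : genMinor d S = 0 := by
      rw [genMinor]
      refine Matrix.det_zero_of_row_eq hne ?_
      ext c''
      rw [Matrix.submatrix_apply, Matrix.submatrix_apply, hcc']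
    rw [h0, l1Norm_zero]
    exact Nat.zero_le _

end Minor

end Literature.RingTheory.MvPolynomial.KaltofenBounds

end
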